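import Literature.NumberTheory.LFunctions.LandauSiegelZerosLocalHypothesisH
import Literature.NumberTheory.LFunctions.SymmetricHadamardNodes
import Literature.NumberTheory.LFunctions.LagariasDifferencedXiCharProofs
import Literature.NumberTheory.LFunctions.DirichletXiPairHadamard
import Literature.NumberTheory.LFunctions.DirichletLZeroCounting
import Literature.NumberTheory.LFunctions.RiemannXiOrderProofs
import Literature.NumberTheory.LFunctions.RiemannXiProofs
import Literature.NumberTheory.LFunctions.RiemannXiLogDeriv
import Literature.NumberTheory.LFunctions.LogDerivAtOneExplicitZeroSumsProofs
import Literature.NumberTheory.LFunctions.ExplicitFormulaPsiCharConst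
import Literature.NumberTheory.LFunctions.DirichletLFunctionBounds
import Literature.Analysis.SpecialFunctions.PolygammaSeries
import Literature.Analysis.Complex.OneSidedPowerSumTsum
import Mathlib.NumberTheory.LSeries.Deriv
import HarnessLib
import Summits.Parity.GeneralizedHardyLittlewood.Theorems.UnboundedSiegelZeros

/-!
# Landau–Siegel zeros under the local hypothesis `H_δ`: PROOF of Basak–Thorner–Zaharescu's Theorem 1.1

Stage A (the higher-derivative explicit formula for the four-function family `ζ, χ₁, χ₂, ψ`) and Stage B
(Lemmas 3.2′–3.4, the endgame, and the discharge `basakThornerZaharescu2026_theorem11_holds`).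

Topic `Literature/NumberTheory/LFunctions` (namespace `Literature.NumberTheory.LFunctions`, objects in the
sub-namespace `BasakThornerZaharescu2026`). Companion of the STATEMENT file
`LandauSiegelZerosLocalHypothesisH.lean` (`basakThornerZaharescu2026_theorem11`, the named fact; untouched).
Everything here is PROVED (theorems only, no definitions of `Prop`s, no named facts).

Source followed: D. Basak, J. Thorner, A. Zaharescu, *Remarks on Landau–Siegel zeros*, Algebra & Number
Theory **20** (2026) 209–217 = arXiv:2404.16003, §2 (Preliminaries) and §3 (proof of Theorem 1.1), read whole
on the held copy `paper:arxiv-2404.16003` pp. 4–6.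

## Architecture of the printed proof and its transplant onto the tree

Printed (§3): for distinct primitive real `χ₁ (mod q₁)`, `χ₂ (mod q₂)` and `ψ` the primitive character
inducing `χ₁χ₂`, the function `D(s) = ζ(s)L(s,χ₁)L(s,χ₂)L(s,ψ)` has (i) a Dirichlet series `−D'/D = Σ a_D(n)n^{−s}`
with `a_D(n) ≥ 0` («`D` is the Dedekind zeta function of a biquadratic field») and (ii) a Hadamard product; equating
the `(kℓ−1)`-th derivatives of both expressions at `s = 1 + η` gives **Lemma 3.1**
`η^{−kℓ} − (1+η−β₁)^{−kℓ} ≥ (1+η−β₂)^{−kℓ} + Re Σ_{Im ω ≠ 0} (1+η−ω)^{−kℓ}`; **Lemma 3.2** bounds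
`K = Σ_j |z_j|/|z₁| ≤ 5` for `z_j = (1+η−ω_j)^{−ℓ}` by the explicit zero count of Bennett–Martin–O'Bryant–Rechnitzer;
**Lemma 3.3** is Turán's one-sided power sum inequality; **Lemma 3.4** (Bernoulli) and the endgame (p. 6) conclude.

Transplant (Stage A = the ENGINE; Stage B = Lemmas 3.2′/3.3/3.4 + endgame ⇒ `_holds`):

* the Hadamard side is the tree's abstract engine for SYMMETRIC entire functions
  (`Stark1974.SymmHadamardData`, `SymmetricHadamardExpansion/Derivatives/Nodes.lean`:
  `(F'/F)^{(k)}(s) = (−1)^k k!(2m(s−½)^{−k−1} + Σₙ Zₙ(k,s))`), applied to `F = Ξ_χ = ξ(·,χ)ξ(·,χ̄)`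
  (`DirichletTheta.xiPair`, genus-zero growth from `Lagarias2005Char.exists_norm_dirichletXi_le_exp`) and to
  `F = ξ` (`riemannXi`, growth `riemannXi_order_le_one_holds`) — `nonempty_symmHadamardData_xiPair`,
  `nonempty_symmHadamardData_riemannXi`; for a REAL `χ`, `Ξ_χ = ξ(·,χ)²`, which is why every `L(s,χ)`-zero
  is carried twice and `ζ` enters with weight `2` (`D² ↔ ξ² · Ξ_{χ₁} Ξ_{χ₂} Ξ_ψ`);
* the Gamma side (trivial zeros) is `PolygammaSeries.hasSum_iteratedDeriv_digamma_half`;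
* the Dirichlet side is Mathlib's `LSeries_iteratedDeriv` with `−L'/L(s,χ) = L(χΛ, s)`;
* the nonnegativity `a_D(n) ≥ 0` is proved CHARACTER-THEORETICALLY (not via `ζ_K`):
  `0 ≤ 1 + χ₁(n) + χ₂(n) + ψ(n)` at prime powers (`re_coeff_nonneg`), using Mathlib's conductor theory
  (`conductor_changeLevel`, `mem_conductorSet_iff_conductor_dvd`, `primitiveCharacter_apply_of_isCoprime`).

Main results of Stage A: `xiPair_explicitFormula` / `riemannXi_explicitFormula` (the explicit formulae for the
`k`-th derivatives, `k ≥ 1`, at any `s` with `Re s > 1`) and **`family_nodeSum_re_le`** = Lemma 3.1 in node form: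
at a real `σ > 1`, `Re[2·N_ξ(k,σ) + N_{Ξ_{χ₁}}(k,σ) + N_{Ξ_{χ₂}}(k,σ) + N_{Ξ_ψ}(k,σ)] ≤ 2(σ−1)^{−(k+1)}`,
where `N_F(k,σ) = 2m(σ−½)^{−(k+1)} + Σₙ Zₙ(k,σ)` is the full node sum of `F`.

Stage B (§B.1–§B.8 below), at the printed point `σ = 1 + η`, `η = δ/e + β₂ − 1 ∈ [δ/(2e), δ/e)`,
`ℓ = ⌈log log q₁⌉`: §B.1 splits each node sum into REAL nodes (non-negative terms; `β₁`, `β₂` are double nodes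
of `Ξ_{χ₁}`, `Ξ_{χ₂}` — `exists_two_real_nodes`) and NON-REAL nodes (`sum_add_re_tsum_nonreal_le`); `H_δ` puts
every non-real node at distance `≥ δ` from `σ` (`nodes_far_xiPair`, `nodes_far_riemannXi`), so **Lemma 3.2′**
(`tsum_nonreal_norm_le` + the order-0 bounds `Re Ξ_χ'/Ξ_χ(σ) ≤ log q + 2 + 2/(σ−1)`, `Re ξ'/ξ(σ) ≤ 2 + 1/(σ−1)`
of §B.2 + `K_step`) bounds the weighted ratio `Σ_j b_j|z_j| / (b₁|z₁|) ≤ 3`; **Lemma 3.3** is the tree's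
`PowerSum.exists_re_tsum_powerSum_ge` (`1 ≤ m ≤ 13·3 = 39`, constant `1/106`), giving with Lemma 3.1
`(1/106)(e/δ)^{mℓ} ≤ η^{−mℓ} − (1+η−β₁)^{−mℓ}` (`powersum_step`); **Lemma 3.4** is `bernoulli_step`, and the
last page of the print is `log_step` with the margins of §B.3 certified as KERNEL LEMMAS against the printed
threshold: `10⁴/(δ³ε²) ≥ 10⁷` (`exponent_ge`), `e^{−10⁴/(δ³ε)} < δε/1000` (`exp_neg_exponent_lt`, so
`(log q)^{−ε} ≤ (log q₀)^{−ε} < δε/1000 ≤ δ/(2e)`), `log(49608·L₂/δ) ≤ εL₂/2` for `L₂ ≥ 10⁴/(δ³ε²)` (`log_margin`,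
the print's «`ε > 2 log(1920η⁻¹ log log q₁)/log log q₁`» with this file's `4134 = 106·39`, `49608 = 12·4134`),
`10 + 44/δ ≤ 3 log q₁` (`K_margin`). The endgame: `1 − β₂ ≥ (δ/e)·ε/312 ≥ δε/1000 > (log q₂)^{−ε} ≥ 1 − β₂`
(`core_contradiction`); §B.8 builds `ψ = (χ₁'χ₂').primitiveCharacter` (real, primitive, `≠ 1`, conductor
`≤ q₁q₂`) and discharges both clauses of the named fact (`basakThornerZaharescu2026_theorem11_holds`).

DECLARED DEVIATIONS from print (all immaterial to the statement proved, which is Theorem 1.1 AS TYPED with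
the printed `q₀ = exp(exp(10⁴/(δ³ε²)))`): (1) `a_D(n) ≥ 0` by characters instead of the Dedekind zeta function of
the biquadratic field; (2) Lemma 3.2's `K ≤ 5`, printed from the explicit `N(T,χ)` of [MR4232231]
(a NAMED FACT in the tree, `bmor2021_theorem11`, deliberately NOT used), is replaced by the order-2 `M`-bound of
Lagarias–Montgomery–Odlyzko 1979 §5 / Thorner–Zaman 2017 Lemma 7.4 (`tsum_nodeWt_mul_norm_inv_sq_le`), with
weaker but explicit constants absorbed by the printed `q₀`; (3) Turán's theorem is used in the Kolesnikov–Straus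
form of the tree (`1/106`, `m ≤ 13K`) instead of the print's (`1/8`, `k ≤ 24K`), again absorbed by `q₀`
(the print's `1920 = 8·2·120` becomes `4134 = 106·39`; the margin `ε/480` becomes `ε/312`).

## References

* [BasakThornerZaharescu2026] D. Basak, J. Thorner, A. Zaharescu, Algebra & Number Theory 20 (2026) 209–217,
  §2 (2.1)–(2.7), §3 Lemmas 3.1–3.4 and the proof of Theorem 1.1.
* [LagariasMontgomeryOdlyzko1979] Invent. Math. 54 (1979), §3, §5. [ThornerZaman2017] Algebra Number Theory 11
  (2017), §7. [MontgomeryVaughan2007] §10.1–10.2. Turán's power-sum theorem in the Kolesnikov–Straus form: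
  the tree's `Literature/Analysis/Complex/OneSidedPowerSumTsum.lean` (and its references).
-/

noncomputable section

open Complex Filter Topology Set Metric
open scoped ComplexConjugate LSeries.notation ArithmeticFunction.vonMangoldt

namespace Literature.NumberTheory.LFunctions

namespace BasakThornerZaharescu2026

open Literature.NumberTheory.LFunctions.Stark1974 Literature.Analysis.Complex DirichletTheta
open Literature.Analysis.SpecialFunctions.Complex (hasSum_iteratedDeriv_digamma_half)

/-! ### §A.1 Hadamard data for `Ξ_χ` and for `ξ` -/

/-- Young-type splitting: `A x^{3/2} ≤ x^{7/4} + A⁷` for `A, x ≥ 0`. [folklore] -/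
private theorem mul_rpow_three_halves_le {A x : ℝ} (hA : 0 ≤ A) (hx : 0 ≤ x) :
    A * x ^ (3 / 2 : ℝ) ≤ x ^ (7 / 4 : ℝ) + A ^ 7 := by
  have h32 : 0 ≤ x ^ (3 / 2 : ℝ) := Real.rpow_nonneg hx _
  have h74 : 0 ≤ x ^ (7 / 4 : ℝ) := Real.rpow_nonneg hx _
  have hA7 : 0 ≤ A ^ 7 := pow_nonneg hA 7
  rcases le_or_gt A (x ^ (1 / 4 : ℝ)) with hle | hlt
  · have hmul : x ^ (1 / 4 : ℝ) * x ^ (3 / 2 : ℝ) = x ^ (7 / 4 : ℝ) := by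
      rcases hx.eq_or_lt with h0 | hpos
      · subst h0
        simp [Real.zero_rpow (by norm_num : (7 / 4 : ℝ) ≠ 0), Real.zero_rpow (by norm_num : (3 / 2 : ℝ) ≠ 0)]
      · rw [← Real.rpow_add hpos]; norm_num
    calc A * x ^ (3 / 2 : ℝ) ≤ x ^ (1 / 4 : ℝ) * x ^ (3 / 2 : ℝ) := by gcongr
      _ = x ^ (7 / 4 : ℝ) := hmul
      _ ≤ x ^ (7 / 4 : ℝ) + A ^ 7 := le_add_of_nonneg_right hA7
  · have h14 : 0 ≤ x ^ (1 / 4 : ℝ) := Real.rpow_nonneg hx _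
    have hpow : x ^ (3 / 2 : ℝ) = (x ^ (1 / 4 : ℝ)) ^ (6 : ℕ) := by
      rw [← Real.rpow_natCast, ← Real.rpow_mul hx]; norm_num
    have hlt6 : (x ^ (1 / 4 : ℝ)) ^ (6 : ℕ) ≤ A ^ 6 := pow_le_pow_left₀ h14 hlt.le 6
    calc A * x ^ (3 / 2 : ℝ) = A * (x ^ (1 / 4 : ℝ)) ^ (6 : ℕ) := by rw [hpow]
      _ ≤ A * A ^ 6 := by gcongr
      _ = A ^ 7 := by ring
      _ ≤ x ^ (7 / 4 : ℝ) + A ^ 7 := le_add_of_nonneg_left h74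

section Dirichlet

variable {q : ℕ} [NeZero q] {χ : DirichletCharacter ℂ q}

omit [NeZero q] in
/-- The inverse of a primitive character is primitive. [folklore] -/
private theorem isPrimitive_inv (hχ : χ.IsPrimitive) : χ⁻¹.IsPrimitive := by
  rw [DirichletCharacter.isPrimitive_def, DirichletCharacter.conductor_inv]; exact hχ

/-- **Growth of `Ξ_χ` of order `< 2`**: `‖Ξ_χ(s)‖ ≤ C·exp(‖s‖^{7/4})` (primitive `χ ≠ 1`), from
`‖ξ(s,χ)‖, ‖ξ(s,χ̄)‖ ≤ exp(K‖s‖^{3/2})` for `‖s‖ ≥ 3` and continuity on `‖s‖ ≤ 3`.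
[cite: MontgomeryVaughan2007, Lemma 10.15] -/
theorem exists_norm_xiPair_le_exp (hχ : χ.IsPrimitive) (h1 : χ ≠ 1) :
    ∃ C : ℝ, ∀ s : ℂ, ‖xiPair χ s‖ ≤ C * Real.exp (‖s‖ ^ (7 / 4 : ℝ)) := by
  obtain ⟨K₁, hK₁, hb₁⟩ := Lagarias2005Char.exists_norm_dirichletXi_le_exp hχ h1
  obtain ⟨K₂, hK₂, hb₂⟩ :=
    Lagarias2005Char.exists_norm_dirichletXi_le_exp (isPrimitive_inv hχ) (inv_ne_one.mpr h1)
  obtain ⟨B, hB⟩ := (isCompact_closedBall (0 : ℂ) 3).exists_bound_of_continuousOn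
    ((differentiable_xiPair h1).continuous.continuousOn)
  set A : ℝ := K₁ + K₂ with hA
  have hA0 : 0 ≤ A := by positivity
  refine ⟨max B 1 * Real.exp (A ^ 7), fun s ↦ ?_⟩
  have hmax1 : 1 ≤ max B 1 := le_max_right _ _
  have hexp1 : 1 ≤ Real.exp (‖s‖ ^ (7 / 4 : ℝ)) := Real.one_le_exp (Real.rpow_nonneg (norm_nonneg _) _)
  have heA : 1 ≤ Real.exp (A ^ 7) := Real.one_le_exp (pow_nonneg hA0 7)
  rcases le_or_gt 3 ‖s‖ with h3 | h3
  · have h := norm_mul_le (dirichletXi χ s) (dirichletXi χ⁻¹ s)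
    have e : xiPair χ s = dirichletXi χ s * dirichletXi χ⁻¹ s := rfl
    rw [e]
    calc ‖dirichletXi χ s * dirichletXi χ⁻¹ s‖
        ≤ ‖dirichletXi χ s‖ * ‖dirichletXi χ⁻¹ s‖ := h
      _ ≤ Real.exp (K₁ * ‖s‖ ^ (3 / 2 : ℝ)) * Real.exp (K₂ * ‖s‖ ^ (3 / 2 : ℝ)) :=
          mul_le_mul (hb₁ s h3) (hb₂ s h3) (norm_nonneg _) (Real.exp_pos _).le
      _ = Real.exp (A * ‖s‖ ^ (3 / 2 : ℝ)) := by rw [← Real.exp_add, hA]; ring_nf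
      _ ≤ Real.exp (‖s‖ ^ (7 / 4 : ℝ) + A ^ 7) :=
          Real.exp_le_exp.2 (mul_rpow_three_halves_le hA0 (norm_nonneg _))
      _ = 1 * Real.exp (A ^ 7) * Real.exp (‖s‖ ^ (7 / 4 : ℝ)) := by rw [Real.exp_add]; ring
      _ ≤ max B 1 * Real.exp (A ^ 7) * Real.exp (‖s‖ ^ (7 / 4 : ℝ)) := by gcongr
  · have hs : s ∈ closedBall (0 : ℂ) 3 := by
      rw [mem_closedBall, dist_zero_right]; exact h3.le
    calc ‖xiPair χ s‖ ≤ B := hB s hs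
      _ ≤ max B 1 := le_max_left _ _
      _ = max B 1 * 1 * 1 := by ring
      _ ≤ max B 1 * Real.exp (A ^ 7) * Real.exp (‖s‖ ^ (7 / 4 : ℝ)) := by gcongr

/-- The zeros of `Ξ_χ` lie in the critical strip, in particular in `Re s ≤ 1`. [cite: MontgomeryVaughan2007, Cor 10.8] -/
theorem re_le_one_of_xiPair_eq_zero (hχ : χ.IsPrimitive) (h1 : χ ≠ 1) {s : ℂ} (hs : xiPair χ s = 0) :
    s.re ≤ 1 := by
  have e : xiPair χ s = dirichletXi χ s * dirichletXi χ⁻¹ s := rfl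
  rw [e, mul_eq_zero] at hs
  by_contra hlt
  push Not at hlt
  rcases hs with h | h
  · exact dirichletXi_ne_zero_of_not_mem_strip hχ h1 (Or.inr hlt.le) h
  · exact dirichletXi_ne_zero_of_not_mem_strip (isPrimitive_inv hχ) (inv_ne_one.mpr h1) (Or.inr hlt.le) h

/-- **The symmetric Hadamard expansion applies to `Ξ_χ`** (primitive `χ ≠ 1`): `Ξ_χ(1−s) = Ξ_χ(s)`, entire of
order `< 2`, zeros in `Re s ≤ 1`. [cite: Conway1978, Ch. XI Thm. 3.4] -/
theorem nonempty_symmHadamardData_xiPair (hχ : χ.IsPrimitive) (h1 : χ ≠ 1) :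
    Nonempty (SymmHadamardData (xiPair χ)) := by
  obtain ⟨C, hC⟩ := exists_norm_xiPair_le_exp hχ h1
  exact exists_symmHadamardData (differentiable_xiPair h1) (xiPair_one_sub hχ)
    (by norm_num : (7 / 4 : ℝ) < 2) (by norm_num) hC (fun s hs ↦ re_le_one_of_xiPair_eq_zero hχ h1 hs)

end Dirichlet

/-- `log(1 + x) ≤ 2 + 2√x` for `x ≥ 0` (`log y ≤ 2(√y − 1)`, `√(1+x) ≤ 1 + √x`). [folklore] -/
private theorem log_one_add_le_two_add_two_sqrt {x : ℝ} (hx : 0 ≤ x) : Real.log (1 + x) ≤ 2 + 2 * Real.sqrt x := by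
  have h1 : 0 < 1 + x := by linarith
  have hs : Real.log (1 + x) = 2 * Real.log (Real.sqrt (1 + x)) := by
    rw [Real.log_sqrt h1.le]; ring
  have h2 : Real.log (Real.sqrt (1 + x)) ≤ Real.sqrt (1 + x) - 1 :=
    Real.log_le_sub_one_of_pos (Real.sqrt_pos.2 h1)
  have h3 : Real.sqrt (1 + x) ≤ 1 + Real.sqrt x := by
    rw [Real.sqrt_le_left (by positivity)]
    nlinarith [Real.sq_sqrt hx, Real.sqrt_nonneg x]
  rw [hs]; linarith

/-- **Growth of `ξ` of order `< 2`**: `‖ξ(s)‖ ≤ C·exp(‖s‖^{7/4})`, from the tree's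
`‖ξ(s)‖ ≤ C₀ exp(12‖s‖ log(1+‖s‖))` (`riemannXi_order_le_one_holds`). [cite: Titchmarsh1986, Thm. 2.12] -/
theorem exists_norm_riemannXi_le_exp :
    ∃ C : ℝ, ∀ s : ℂ, ‖riemannXi s‖ ≤ C * Real.exp (‖s‖ ^ (7 / 4 : ℝ)) := by
  obtain ⟨A, C₀, hA, hC₀, h⟩ := riemannXi_order_le_one_holds.nonneg
  refine ⟨C₀ * Real.exp ((4 * A) ^ 7 + 2 * A), fun s ↦ ?_⟩
  set x : ℝ := ‖s‖ with hx
  have hx0 : 0 ≤ x := norm_nonneg _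
  have hsq : Real.sqrt x = x ^ (1 / 2 : ℝ) := Real.sqrt_eq_rpow x
  -- `A x log(1+x) ≤ 2A x + 2A x √x ≤ 2A + 4A x^{3/2} ≤ x^{7/4} + (4A)^7 + 2A`
  have hx32 : x * Real.sqrt x = x ^ (3 / 2 : ℝ) := by
    rw [hsq]
    rcases hx0.eq_or_lt with h0 | hpos
    · rw [← h0]; simp [Real.zero_rpow (by norm_num : (3 / 2 : ℝ) ≠ 0)]
    · rw [show (3 / 2 : ℝ) = 1 + 1 / 2 by norm_num, Real.rpow_add hpos, Real.rpow_one]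
  have hxle : x ≤ 1 + x ^ (3 / 2 : ℝ) := by
    rcases le_or_gt x 1 with hx1 | hx1
    · linarith [Real.rpow_nonneg hx0 (3 / 2 : ℝ)]
    · have : x ≤ x ^ (3 / 2 : ℝ) := by
        calc x = x ^ (1 : ℝ) := (Real.rpow_one x).symm
          _ ≤ x ^ (3 / 2 : ℝ) := Real.rpow_le_rpow_of_exponent_le hx1.le (by norm_num)
      linarith
  have hkey : A * x * Real.log (1 + x) ≤ x ^ (7 / 4 : ℝ) + ((4 * A) ^ 7 + 2 * A) := by
    have hl := log_one_add_le_two_add_two_sqrt hx0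
    have hAx : 0 ≤ A * x := mul_nonneg hA hx0
    have h1 : A * x * Real.log (1 + x) ≤ A * x * (2 + 2 * Real.sqrt x) :=
      mul_le_mul_of_nonneg_left hl hAx
    have h2 : A * x * (2 + 2 * Real.sqrt x) = 2 * A * x + 2 * A * x ^ (3 / 2 : ℝ) := by
      rw [← hx32]; ring
    have h3 : 2 * A * x ≤ 2 * A + 2 * A * x ^ (3 / 2 : ℝ) := by nlinarith
    have h4 := mul_rpow_three_halves_le (show 0 ≤ 4 * A by positivity) hx0
    linarith
  calc ‖riemannXi s‖ ≤ C₀ * Real.exp (A * ‖s‖ * Real.log (1 + ‖s‖)) := h s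
    _ ≤ C₀ * Real.exp (x ^ (7 / 4 : ℝ) + ((4 * A) ^ 7 + 2 * A)) := by
        rw [← hx]; gcongr
    _ = C₀ * Real.exp ((4 * A) ^ 7 + 2 * A) * Real.exp (‖s‖ ^ (7 / 4 : ℝ)) := by
        rw [Real.exp_add, hx]; ring

/-- **The symmetric Hadamard expansion applies to `ξ`**: `ξ(1−s) = ξ(s)`, entire of order `≤ 1`, zeros in the
critical strip. [cite: Conway1978, Ch. XI Thm. 3.4] -/
theorem nonempty_symmHadamardData_riemannXi : Nonempty (SymmHadamardData riemannXi) := by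
  obtain ⟨C, hC⟩ := exists_norm_riemannXi_le_exp
  exact exists_symmHadamardData differentiable_riemannXi riemannXi_one_sub
    (by norm_num : (7 / 4 : ℝ) < 2) (by norm_num) hC
    (fun s hs ↦ ((riemannXi_eq_zero_iff_holds s).1 hs).2.2.le)


/-! ### §A.2 The Gamma side: higher derivatives of `Γ_ℝ'/Γ_ℝ(· + a)` (the trivial-zero terms) -/

/-- **`(d/dz)^k [Γ_ℝ'/Γ_ℝ(z + a)](s) = (−1)^{k+1} k! Σ_{j≥0} (s + a + 2j)^{−(k+1)}`** for real `a ≥ 0`,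
`Re s > 0`, `k ≥ 1` (`Γ_ℝ'/Γ_ℝ(w) = −½log π + ½ψ(w/2)` and the polygamma series): the trivial zeros
`−a − 2j` of `L(s, χ)` (`a = κ` the parity) resp. of `ζ` (`a = 0`, `j ≥ 1`, plus the pole of `1/s`).
[cite: ThornerZaman2017, §7 (7.3)] [cite: AndrewsAskeyRoy1999, Thm 1.2.5 (1.2.14)] -/
theorem hasSum_iteratedDeriv_logDeriv_Gammaℝ_add {a : ℝ} (ha : 0 ≤ a) {s : ℂ} (hs : 0 < s.re) {k : ℕ}
    (hk : 1 ≤ k) :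
    HasSum (fun j : ℕ ↦ (-1) ^ (k + 1) * (k.factorial : ℂ) * ((s + a + 2 * j) ^ (k + 1))⁻¹)
      (iteratedDeriv k (fun z : ℂ ↦ logDeriv Gammaℝ (z + a)) s) := by
  have hU : IsOpen {w : ℂ | 0 < w.re} := isOpen_lt continuous_const continuous_re
  have hsa : 0 < (s + (a : ℂ)).re := by rw [add_re, ofReal_re]; linarith
  -- near `s`: `Γ_ℝ'/Γ_ℝ(z + a) = −(log π)/2 + ψ((z + a)/2)/2`
  have hev : (fun z : ℂ ↦ logDeriv Gammaℝ (z + a)) =ᶠ[𝓝 s]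
      fun z ↦ -(Complex.log Real.pi) / 2 + (fun w : ℂ ↦ digamma (w / 2) / 2) (z + a) := by
    filter_upwards [hU.mem_nhds hs] with z hz
    have hz0 : 0 < z.re := hz
    have hpole : ∀ m : ℕ, (z + (a : ℂ)) / 2 ≠ -(m : ℂ) := by
      intro m h
      have := congrArg Complex.re h
      rw [div_ofNat_re, add_re, ofReal_re, neg_re, natCast_re] at this
      have hm : (0 : ℝ) ≤ m := Nat.cast_nonneg m
      linarith
    rw [LFunctions.logDeriv_Gammaℝ hpole]
  rw [hev.iteratedDeriv_eq, iteratedDeriv_const_add hk, iteratedDeriv_comp_add_const k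
    (fun w : ℂ ↦ digamma (w / 2) / 2) (a : ℂ)]
  have h := hasSum_iteratedDeriv_digamma_half hsa hk
  refine h.congr_fun fun j ↦ ?_
  ring_nf

section Dirichlet

variable {q : ℕ} [NeZero q] {χ : DirichletCharacter ℂ q}

/-! ### §A.3 The explicit formula for the pair `−L'/L(s,χ) − L'/L(s,χ̄)` -/

omit [NeZero q] in
/-- The abscissa of absolute convergence of `χΛ` is at most `1`. [folklore] -/
private theorem abscissaOfAbsConv_twist_vonMangoldt_le' (χ : DirichletCharacter ℂ q) :
    LSeries.abscissaOfAbsConv (↗χ * ↗Λ) ≤ 1 :=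
  LSeries.abscissaOfAbsConv_le_of_forall_lt_LSeriesSummable fun y hy =>
    DirichletCharacter.LSeriesSummable_twist_vonMangoldt χ (by simpa using hy)

omit [NeZero q] in
/-- `Re s > 1` is inside the half-plane of absolute convergence of `χΛ`. [folklore] -/
private theorem abscissaOfAbsConv_twist_vonMangoldt_lt (χ : DirichletCharacter ℂ q) {s : ℂ} (hs : 1 < s.re) :
    LSeries.abscissaOfAbsConv (↗χ * ↗Λ) < s.re :=
  lt_of_le_of_lt (abscissaOfAbsConv_twist_vonMangoldt_le' χ) (by exact_mod_cast hs)

/-- On `Re s > 1`: `L'/L(s, χ) = −L(χΛ, s)` (as `logDeriv` of Mathlib's `LFunction`). [cite: MontgomeryVaughan2007, §10.1] -/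
theorem logDeriv_LFunction_eq_neg_LSeries (χ : DirichletCharacter ℂ q) {s : ℂ} (hs : 1 < s.re) :
    logDeriv χ.LFunction s = -L (↗χ * ↗Λ) s := by
  rw [DirichletCharacter.LSeries_twist_vonMangoldt_eq χ hs, neg_div, neg_neg, logDeriv_apply,
    DirichletCharacter.deriv_LFunction_eq_deriv_LSeries χ hs, DirichletCharacter.LFunction_eq_LSeries χ hs]

omit [NeZero q] in
/-- `L(χΛ, ·)` is `C^k` at every `s` with `Re s > 1`. [folklore] -/
private theorem contDiffAt_LSeries_twist_vonMangoldt (χ : DirichletCharacter ℂ q) {s : ℂ} (hs : 1 < s.re) (k : ℕ) :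
    ContDiffAt ℂ k (LSeries (↗χ * ↗Λ)) s :=
  (LSeries_analyticOnNhd (↗χ * ↗Λ) s (abscissaOfAbsConv_twist_vonMangoldt_lt χ hs)).contDiffAt

/-- **`Ξ_χ'/Ξ_χ` on `Re s > 1`** (primitive `χ ≠ 1` mod `q`):
`Ξ_χ'/Ξ_χ(s) = log q + 2Γ_ℝ'/Γ_ℝ(s + κ) + L'/L(s, χ) + L'/L(s, χ̄)` (`ξ'/ξ = ½log q + Γ_ℝ'/Γ_ℝ(·+κ) + L'/L`
for `χ` and `χ̄`, which have the same parity `κ`). [cite: MontgomeryVaughan2007, §10.1 (10.19) and Cor 10.8] -/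
theorem logDeriv_xiPair_eq (hχ : χ.IsPrimitive) (h1 : χ ≠ 1) {s : ℂ} (hs : 1 < s.re) :
    logDeriv (xiPair χ) s = (Real.log q : ℂ) + 2 * logDeriv Gammaℝ (s + charParity χ) +
      logDeriv χ.LFunction s + logDeriv χ⁻¹.LFunction s := by
  have h1' : χ⁻¹ ≠ 1 := inv_ne_one.mpr h1
  have hχ' : χ⁻¹.IsPrimitive := isPrimitive_inv hχ
  have hs0 : 0 < s.re := by linarith
  have hL : χ.LFunction s ≠ 0 := DirichletCharacter.LFunction_ne_zero_of_one_le_re χ (Or.inl h1) hs.le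
  have hL' : χ⁻¹.LFunction s ≠ 0 := DirichletCharacter.LFunction_ne_zero_of_one_le_re χ⁻¹ (Or.inl h1') hs.le
  have hξ : dirichletXi χ s ≠ 0 := dirichletXi_ne_zero_of_not_mem_strip hχ h1 (Or.inr hs.le)
  have hξ' : dirichletXi χ⁻¹ s ≠ 0 := dirichletXi_ne_zero_of_not_mem_strip hχ' h1' (Or.inr hs.le)
  have hfun : xiPair χ = fun z ↦ dirichletXi χ z * dirichletXi χ⁻¹ z := rfl
  rw [hfun, logDeriv_mul s hξ hξ' (differentiable_dirichletXi h1 _) (differentiable_dirichletXi h1' _)]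
  have e1 : logDeriv (dirichletXi χ) s =
      (Real.log q : ℂ) / 2 + logDeriv Gammaℝ (s + charParity χ) + logDeriv χ.LFunction s := by
    rw [logDeriv_apply]; exact logDeriv_dirichletXi_eq h1 hs0 hL
  have e2 : logDeriv (dirichletXi χ⁻¹) s =
      (Real.log q : ℂ) / 2 + logDeriv Gammaℝ (s + charParity χ) + logDeriv χ⁻¹.LFunction s := by
    rw [logDeriv_apply, ← charParity_inv χ]
    exact logDeriv_dirichletXi_eq h1' hs0 hL'
  rw [e1, e2]; ring

/-- `Ξ_χ(s) ≠ 0` for `Re s > 1`. [cite: MontgomeryVaughan2007, Cor 10.8] -/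
theorem xiPair_ne_zero_of_one_lt_re (hχ : χ.IsPrimitive) (h1 : χ ≠ 1) {s : ℂ} (hs : 1 < s.re) :
    xiPair χ s ≠ 0 := fun h ↦ by
  have := re_le_one_of_xiPair_eq_zero hχ h1 h
  linarith

/-- **The explicit formula for the `k`-th derivatives of the pair `−L'/L(s,χ) − L'/L(s,χ̄)`** (primitive
`χ ≠ 1`, `Re s > 1`, `k ≥ 1`, `D` the Hadamard data of `Ξ_χ`):
`((−1)^k/k!)[(L(χΛ))^{(k)}(s) + (L(χ̄Λ))^{(k)}(s)] = −2Σ_{j≥0}(s + κ + 2j)^{−(k+1)} − (2m(s−½)^{−(k+1)} + Σₙ Zₙ(k,s))`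
— all zeros of `L(s,χ)L(s,χ̄)` (trivial ones in the first sum, non-trivial ones as the nodes `{ρₙ, 1−ρₙ}` of `Ξ_χ`),
true multiplicities, no error term. [cite: ThornerZaman2017, §7 (7.3)] [cite: BasakThornerZaharescu2026, Lemma 3.1 (proof)] -/
theorem xiPair_explicitFormula (hχ : χ.IsPrimitive) (h1 : χ ≠ 1) (D : SymmHadamardData (xiPair χ)) {s : ℂ}
    (hs : 1 < s.re) {k : ℕ} (hk : 1 ≤ k) :
    ((-1) ^ k / k.factorial : ℂ) *
        (iteratedDeriv k (LSeries (↗χ * ↗Λ)) s + iteratedDeriv k (LSeries (↗χ⁻¹ * ↗Λ)) s) =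
      -(2 * ∑' j : ℕ, ((s + charParity χ + 2 * j) ^ (k + 1))⁻¹) -
        (2 * D.m * ((s - 1 / 2) ^ (k + 1))⁻¹ + ∑' n, D.zeroTerm k s n) := by
  have hs0 : 0 < s.re := by linarith
  have hU : ∀ᶠ z : ℂ in 𝓝 s, 1 < z.re := (isOpen_lt continuous_const continuous_re).mem_nhds hs
  set κ : ℝ := (charParity χ : ℝ) with hκ
  have hκ0 : 0 ≤ κ := by rw [hκ]; exact Nat.cast_nonneg _
  have hκc : ((charParity χ : ℕ) : ℂ) = (κ : ℂ) := by rw [hκ]; norm_cast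
  -- the identity of functions near `s`
  have hev : (fun z ↦ LSeries (↗χ * ↗Λ) z + LSeries (↗χ⁻¹ * ↗Λ) z) =ᶠ[𝓝 s] fun z ↦
      (Real.log q : ℂ) + (2 * (fun w : ℂ ↦ logDeriv Gammaℝ (w + κ)) z - logDeriv (xiPair χ) z) := by
    filter_upwards [hU] with z hz
    have h := logDeriv_xiPair_eq hχ h1 hz
    rw [logDeriv_LFunction_eq_neg_LSeries χ hz, logDeriv_LFunction_eq_neg_LSeries χ⁻¹ hz, hκc] at h
    linear_combination h
  -- smoothness of the pieces at `s`
  have hL₁ := contDiffAt_LSeries_twist_vonMangoldt χ hs k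
  have hL₂ := contDiffAt_LSeries_twist_vonMangoldt χ⁻¹ hs k
  have hO : IsOpen {z : ℂ | 0 < z.re} := isOpen_lt continuous_const continuous_re
  have hγ : ContDiffAt ℂ k (fun w : ℂ ↦ logDeriv Gammaℝ (w + κ)) s := by
    have hd : DifferentiableOn ℂ (fun w : ℂ ↦ logDeriv Gammaℝ (w + κ)) {z : ℂ | 0 < z.re} := by
      intro z hz
      have hz' : 0 < (z + (κ : ℂ)).re := by simp at hz ⊢; linarith
      exact ((analyticAt_logDeriv_Gammaℝ hz').differentiableAt.comp z
        (differentiableAt_id.add_const _)).differentiableWithinAt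
    exact (hd.analyticAt (hO.mem_nhds hs0)).contDiffAt
  have hΞne : xiPair χ s ≠ 0 := xiPair_ne_zero_of_one_lt_re hχ h1 hs
  have hΞ : ContDiffAt ℂ k (logDeriv (xiPair χ)) s := by
    have hV : IsOpen {z : ℂ | xiPair χ z ≠ 0} :=
      isOpen_ne_fun (differentiable_xiPair h1).continuous continuous_const
    have hd : DifferentiableOn ℂ (logDeriv (xiPair χ)) {z : ℂ | xiPair χ z ≠ 0} :=
      fun z hz ↦ (SymmHadamardData.differentiableAt_logDeriv (differentiable_xiPair h1) hz).differentiableWithinAt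
    exact (hd.analyticAt (hV.mem_nhds hΞne)).contDiffAt
  have hk0 : 0 < k := hk
  have hlhs : iteratedDeriv k (fun z ↦ LSeries (↗χ * ↗Λ) z + LSeries (↗χ⁻¹ * ↗Λ) z) s =
      iteratedDeriv k (LSeries (↗χ * ↗Λ)) s + iteratedDeriv k (LSeries (↗χ⁻¹ * ↗Λ)) s :=
    iteratedDeriv_fun_add hL₁ hL₂
  have hrhs : iteratedDeriv k (fun z ↦ (Real.log q : ℂ) +
      (2 * (fun w : ℂ ↦ logDeriv Gammaℝ (w + κ)) z - logDeriv (xiPair χ) z)) s =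
      2 * iteratedDeriv k (fun w : ℂ ↦ logDeriv Gammaℝ (w + κ)) s - iteratedDeriv k (logDeriv (xiPair χ)) s := by
    rw [iteratedDeriv_const_add hk0, iteratedDeriv_fun_sub (contDiffAt_const.mul hγ) hΞ,
      iteratedDeriv_const_mul _ hγ]
  have hmain := hev.iteratedDeriv_eq (n := k)
  rw [hlhs, hrhs, D.iteratedDeriv_logDeriv_eq (differentiable_xiPair h1) hΞne k,
    (hasSum_iteratedDeriv_logDeriv_Gammaℝ_add hκ0 hs0 hk).tsum_eq.symm, tsum_mul_left] at hmain
  rw [hmain, hκc]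
  set G : ℂ := ∑' j : ℕ, ((s + κ + 2 * j) ^ (k + 1))⁻¹ with hG
  set Z : ℂ := 2 * D.m * ((s - 1 / 2) ^ (k + 1))⁻¹ + ∑' n, D.zeroTerm k s n with hZ
  have hfac : (k.factorial : ℂ) ≠ 0 := by exact_mod_cast k.factorial_ne_zero
  have hinv : (k.factorial : ℂ) * (k.factorial : ℂ)⁻¹ = 1 := mul_inv_cancel₀ hfac
  have hε : ((-1 : ℂ) ^ k) * (-1) ^ k = 1 := by rw [← mul_pow]; simp
  have e1 : ((-1 : ℂ) ^ (k + 1)) = -(-1) ^ k := by rw [pow_succ, mul_neg_one]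
  rw [e1, div_eq_mul_inv]
  linear_combination ((k.factorial : ℂ) * (k.factorial : ℂ)⁻¹ * (-2 * G - Z)) * hε + (-2 * G - Z) * hinv

end Dirichlet

/-! ### §A.4 The explicit formula for `ζ` -/

/-- The abscissa of absolute convergence of `Λ` is at most `1`. [folklore] -/
private theorem abscissaOfAbsConv_vonMangoldt_lt {s : ℂ} (hs : 1 < s.re) : LSeries.abscissaOfAbsConv ↗Λ < s.re :=
  lt_of_le_of_lt (LSeries.abscissaOfAbsConv_le_of_forall_lt_LSeriesSummable fun y hy =>
    ArithmeticFunction.LSeriesSummable_vonMangoldt (by simpa using hy)) (by exact_mod_cast hs)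

/-- **The explicit formula for the `k`-th derivative of `−ζ'/ζ`** (`Re s > 1`, `k ≥ 1`, `D₀` the Hadamard data
of `ξ`): `((−1)^k/k!)(L(Λ))^{(k)}(s) = (s−1)^{−(k+1)} + s^{−(k+1)} − Σ_{j≥0}(s+2j)^{−(k+1)} − (2m₀(s−½)^{−(k+1)} + Σₙ Zₙ(k,s))`
(`ξ'/ξ = 1/s + 1/(s−1) + Γ_ℝ'/Γ_ℝ + ζ'/ζ`; the `j = 0` term cancels `s^{−(k+1)}`, leaving the trivial zeros
`−2, −4, …`). [cite: ThornerZaman2017, §7 (7.3)] [cite: BasakThornerZaharescu2026, Lemma 3.1 (proof)] -/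
theorem riemannXi_explicitFormula (D : SymmHadamardData riemannXi) {s : ℂ} (hs : 1 < s.re) {k : ℕ}
    (hk : 1 ≤ k) :
    ((-1) ^ k / k.factorial : ℂ) * iteratedDeriv k (LSeries ↗Λ) s =
      ((s - 1) ^ (k + 1))⁻¹ + (s ^ (k + 1))⁻¹ - ∑' j : ℕ, ((s + 2 * j) ^ (k + 1))⁻¹ -
        (2 * D.m * ((s - 1 / 2) ^ (k + 1))⁻¹ + ∑' n, D.zeroTerm k s n) := by
  have hs0 : 0 < s.re := by linarith
  have hs0' : s ≠ 0 := fun h ↦ by rw [h, zero_re] at hs; linarith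
  have hs1 : s ≠ 1 := fun h ↦ by rw [h, one_re] at hs; exact lt_irrefl _ hs
  have hU : ∀ᶠ z : ℂ in 𝓝 s, 1 < z.re := (isOpen_lt continuous_const continuous_re).mem_nhds hs
  -- the identity of functions near `s`
  have hev : (fun z ↦ LSeries ↗Λ z) =ᶠ[𝓝 s] fun z ↦
      ((fun w : ℂ ↦ (w - 0)⁻¹) z + (fun w : ℂ ↦ (w - 1)⁻¹) z) +
        ((fun w : ℂ ↦ logDeriv Gammaℝ (w + (0 : ℝ))) z - logDeriv riemannXi z) := by
    filter_upwards [hU] with z hz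
    have h := logDeriv_riemannXi_eq_of_one_lt_re hz
    have hz0 : 0 < z.re := by linarith
    have hpole : ∀ m : ℕ, z / 2 ≠ -(m : ℂ) := half_ne_neg_nat_of_re_pos' hz0
    have hG : logDeriv Gammaℝ (z + ((0 : ℝ) : ℂ)) = -(Real.log Real.pi : ℂ) / 2 + 1 / 2 * digamma (z / 2) := by
      rw [Complex.ofReal_zero, add_zero, LFunctions.logDeriv_Gammaℝ hpole, ← Complex.ofReal_log Real.pi_pos.le]
      ring
    simp only [sub_zero]
    rw [hG]
    linear_combination h
  -- smoothness
  have hL : ContDiffAt ℂ k (LSeries ↗Λ) s :=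
    (LSeries_analyticOnNhd ↗Λ s (abscissaOfAbsConv_vonMangoldt_lt hs)).contDiffAt
  have hP0 : ContDiffAt ℂ k (fun w : ℂ ↦ (w - 0)⁻¹) s :=
    (contDiffAt_id.sub contDiffAt_const).inv (by simpa using hs0')
  have hP1 : ContDiffAt ℂ k (fun w : ℂ ↦ (w - 1)⁻¹) s :=
    (contDiffAt_id.sub contDiffAt_const).inv (by simpa [sub_eq_zero] using hs1)
  have hO : IsOpen {z : ℂ | 0 < z.re} := isOpen_lt continuous_const continuous_re
  have hγ : ContDiffAt ℂ k (fun w : ℂ ↦ logDeriv Gammaℝ (w + (0 : ℝ))) s := by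
    have hd : DifferentiableOn ℂ (fun w : ℂ ↦ logDeriv Gammaℝ (w + (0 : ℝ))) {z : ℂ | 0 < z.re} := by
      intro z hz
      have hz' : 0 < (z + ((0 : ℝ) : ℂ)).re := by simp at hz ⊢; linarith
      exact ((analyticAt_logDeriv_Gammaℝ hz').differentiableAt.comp z
        (differentiableAt_id.add_const _)).differentiableWithinAt
    exact (hd.analyticAt (hO.mem_nhds hs0)).contDiffAt
  have hΞne : riemannXi s ≠ 0 := riemannXi_ne_zero_of_one_le_re hs.le
  have hΞ : ContDiffAt ℂ k (logDeriv riemannXi) s := by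
    have hV : IsOpen {z : ℂ | riemannXi z ≠ 0} :=
      isOpen_ne_fun differentiable_riemannXi.continuous continuous_const
    have hd : DifferentiableOn ℂ (logDeriv riemannXi) {z : ℂ | riemannXi z ≠ 0} :=
      fun z hz ↦ (SymmHadamardData.differentiableAt_logDeriv differentiable_riemannXi hz).differentiableWithinAt
    exact (hd.analyticAt (hV.mem_nhds hΞne)).contDiffAt
  have hrhs : iteratedDeriv k (fun z ↦ ((fun w : ℂ ↦ (w - 0)⁻¹) z + (fun w : ℂ ↦ (w - 1)⁻¹) z) +
      ((fun w : ℂ ↦ logDeriv Gammaℝ (w + (0 : ℝ))) z - logDeriv riemannXi z)) s =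
      (iteratedDeriv k (fun w : ℂ ↦ (w - 0)⁻¹) s + iteratedDeriv k (fun w : ℂ ↦ (w - 1)⁻¹) s) +
        (iteratedDeriv k (fun w : ℂ ↦ logDeriv Gammaℝ (w + (0 : ℝ))) s - iteratedDeriv k (logDeriv riemannXi) s) := by
    rw [iteratedDeriv_fun_add (hP0.add hP1) (hγ.sub hΞ), iteratedDeriv_fun_add hP0 hP1, iteratedDeriv_fun_sub hγ hΞ]
  have hmain := hev.iteratedDeriv_eq (n := k)
  rw [hrhs, iteratedDeriv_inv_sub_const, iteratedDeriv_inv_sub_const, sub_zero,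
    D.iteratedDeriv_logDeriv_eq differentiable_riemannXi hΞne k,
    (hasSum_iteratedDeriv_logDeriv_Gammaℝ_add le_rfl hs0 hk).tsum_eq.symm, tsum_mul_left] at hmain
  have hmain' : iteratedDeriv k (LSeries ↗Λ) s = iteratedDeriv k (fun z ↦ LSeries ↗Λ z) s := rfl
  rw [hmain', hmain]
  simp only [Complex.ofReal_zero, add_zero]
  set G : ℂ := ∑' j : ℕ, ((s + 2 * j) ^ (k + 1))⁻¹ with hG
  set Z : ℂ := 2 * D.m * ((s - 1 / 2) ^ (k + 1))⁻¹ + ∑' n, D.zeroTerm k s n with hZ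
  set A : ℂ := (s ^ (k + 1))⁻¹ with hA
  set B : ℂ := ((s - 1) ^ (k + 1))⁻¹ with hB
  have hfac : (k.factorial : ℂ) ≠ 0 := by exact_mod_cast k.factorial_ne_zero
  have hinv : (k.factorial : ℂ) * (k.factorial : ℂ)⁻¹ = 1 := mul_inv_cancel₀ hfac
  have hε : ((-1 : ℂ) ^ k) * (-1) ^ k = 1 := by rw [← mul_pow]; simp
  have e1 : ((-1 : ℂ) ^ (k + 1)) = -(-1) ^ k := by rw [pow_succ, mul_neg_one]
  rw [e1, div_eq_mul_inv]
  linear_combination ((k.factorial : ℂ) * (k.factorial : ℂ)⁻¹ * (A + B - G - Z)) * hε + (A + B - G - Z) * hinv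


/-! ### §A.5 The Dirichlet side at a real point `σ > 1`: `Σₙ a_D(n)(log n)^k n^{−σ} ≥ 0` -/

/-- `(log^k · f)(n) = (log n)^k f(n)`. [folklore] -/
private theorem iterate_logMul_apply (f : ℕ → ℂ) (k n : ℕ) :
    (LSeries.logMul^[k] f) n = (Real.log n : ℂ) ^ k * f n := by
  induction k with
  | zero => simp
  | succ k ih => rw [Function.iterate_succ_apply', LSeries.logMul, ih, pow_succ, ← Complex.natCast_log]; ring

/-- The terms of `L(log^k·(aΛ), σ)` at a real point: `a(n)·w_k(n)`, `w_k(n) = (log n)^k Λ(n) n^{−σ} ≥ 0`. [folklore] -/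
private theorem term_iterate_logMul_mul_vonMangoldt (a : ℕ → ℂ) (σ : ℝ) (k n : ℕ) :
    LSeries.term (LSeries.logMul^[k] (a * ↗Λ)) (σ : ℂ) n =
      a n * ((Real.log n ^ k * Λ n / (n : ℝ) ^ σ : ℝ) : ℂ) := by
  rcases eq_or_ne n 0 with rfl | hn
  · simp [LSeries.term_zero]
  · rw [LSeries.term_of_ne_zero hn, iterate_logMul_apply]
    simp only [Pi.mul_apply]
    rw [Complex.ofReal_div, Complex.ofReal_mul, Complex.ofReal_pow, Complex.ofReal_cpow (Nat.cast_nonneg n),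
      Complex.ofReal_natCast, Complex.natCast_log]
    ring

/-- The weight `w_k(n) = (log n)^k Λ(n) n^{−σ}` is non-negative. [folklore] -/
private theorem weight_nonneg (σ : ℝ) (k n : ℕ) : 0 ≤ Real.log n ^ k * Λ n / (n : ℝ) ^ σ :=
  div_nonneg (mul_nonneg (pow_nonneg (Real.log_natCast_nonneg n) k) ArithmeticFunction.vonMangoldt_nonneg)
    (Real.rpow_nonneg (Nat.cast_nonneg n) σ)

section Dirichlet

variable {q : ℕ} [NeZero q]

omit [NeZero q] in
/-- **`L(log^k·χΛ, σ) = Σₙ χ(n) w_k(n)`** at a real `σ > 1`. [folklore] -/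
private theorem hasSum_twist_weight (χ : DirichletCharacter ℂ q) {σ : ℝ} (hσ : 1 < σ) (k : ℕ) :
    HasSum (fun n : ℕ ↦ χ n * ((Real.log n ^ k * Λ n / (n : ℝ) ^ σ : ℝ) : ℂ))
      (LSeries (LSeries.logMul^[k] (↗χ * ↗Λ)) σ) := by
  have hs : LSeries.abscissaOfAbsConv (LSeries.logMul^[k] (↗χ * ↗Λ)) < ((σ : ℂ)).re := by
    rw [LSeries.absicssaOfAbsConv_logPowMul]
    exact abscissaOfAbsConv_twist_vonMangoldt_lt χ (by simpa using hσ)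
  have h := (LSeriesSummable_of_abscissaOfAbsConv_lt_re hs).hasSum
  exact h.congr_fun fun n ↦ (term_iterate_logMul_mul_vonMangoldt (fun n : ℕ ↦ χ n) σ k n).symm

omit [NeZero q] in
/-- `((−1)^k/k!)·(L(χΛ))^{(k)}(σ) = (1/k!)·L(log^k·χΛ, σ)` (`Re σ > 1`). [folklore] -/
private theorem iteratedDeriv_LSeries_twist_eq (χ : DirichletCharacter ℂ q) {s : ℂ} (hs : 1 < s.re) (k : ℕ) :
    ((-1) ^ k / k.factorial : ℂ) * iteratedDeriv k (LSeries (↗χ * ↗Λ)) s =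
      (k.factorial : ℂ)⁻¹ * LSeries (LSeries.logMul^[k] (↗χ * ↗Λ)) s := by
  rw [LSeries_iteratedDeriv k (abscissaOfAbsConv_twist_vonMangoldt_lt χ hs)]
  have hε : ((-1 : ℂ) ^ k) * (-1) ^ k = 1 := by rw [← mul_pow]; simp
  rw [div_eq_mul_inv]
  linear_combination ((k.factorial : ℂ)⁻¹ * LSeries (LSeries.logMul^[k] (↗χ * ↗Λ)) s) * hε

end Dirichlet

/-- **`L(log^k·Λ, σ) = Σₙ w_k(n)`** at a real `σ > 1`. [folklore] -/
private theorem hasSum_weight {σ : ℝ} (hσ : 1 < σ) (k : ℕ) :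
    HasSum (fun n : ℕ ↦ ((Real.log n ^ k * Λ n / (n : ℝ) ^ σ : ℝ) : ℂ)) (LSeries (LSeries.logMul^[k] ↗Λ) σ) := by
  have hs : LSeries.abscissaOfAbsConv (LSeries.logMul^[k] ↗Λ) < ((σ : ℂ)).re := by
    rw [LSeries.absicssaOfAbsConv_logPowMul]
    exact abscissaOfAbsConv_vonMangoldt_lt (by simpa using hσ)
  have h := (LSeriesSummable_of_abscissaOfAbsConv_lt_re hs).hasSum
  have hfun : (↗Λ : ℕ → ℂ) = (fun _ : ℕ ↦ (1 : ℂ)) * ↗Λ := by funext n; simp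
  refine h.congr_fun fun n ↦ ?_
  have := term_iterate_logMul_mul_vonMangoldt (fun _ : ℕ ↦ (1 : ℂ)) σ k n
  rw [← hfun, one_mul] at this
  exact this.symm

/-- `((−1)^k/k!)·(L(Λ))^{(k)}(s) = (1/k!)·L(log^k·Λ, s)` (`Re s > 1`). [folklore] -/
private theorem iteratedDeriv_LSeries_vonMangoldt_eq {s : ℂ} (hs : 1 < s.re) (k : ℕ) :
    ((-1) ^ k / k.factorial : ℂ) * iteratedDeriv k (LSeries ↗Λ) s =
      (k.factorial : ℂ)⁻¹ * LSeries (LSeries.logMul^[k] ↗Λ) s := by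
  rw [LSeries_iteratedDeriv k (abscissaOfAbsConv_vonMangoldt_lt hs)]
  have hε : ((-1 : ℂ) ^ k) * (-1) ^ k = 1 := by rw [← mul_pow]; simp
  rw [div_eq_mul_inv]
  linear_combination ((k.factorial : ℂ)⁻¹ * LSeries (LSeries.logMul^[k] ↗Λ) s) * hε

/-- **The trivial-zero sums are real, summable and bounded below by their first term**: for real `σ > 1`,
`a ≥ 0`, `k ≥ 1`: `Σ_{j≥0}(σ + a + 2j)^{−(k+1)}` (as a complex number) is the real number `Σ_j t_j`, with
`t_j = (σ + a + 2j)^{−(k+1)} ≥ 0` summable and `t_0 ≤ Σ_j t_j`. [folklore] -/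
private theorem trivialSum_eq_ofReal {σ a : ℝ} (hσ : 1 < σ) (ha : 0 ≤ a) {k : ℕ} (hk : 1 ≤ k) :
    Summable (fun j : ℕ ↦ ((σ + a + 2 * j) ^ (k + 1))⁻¹) ∧
    (∑' j : ℕ, ((((σ : ℂ)) + a + 2 * j) ^ (k + 1))⁻¹) = ((∑' j : ℕ, ((σ + a + 2 * j) ^ (k + 1))⁻¹ : ℝ) : ℂ) ∧
    ((σ + a) ^ (k + 1))⁻¹ ≤ ∑' j : ℕ, ((σ + a + 2 * j) ^ (k + 1))⁻¹ := by
  have hnn : ∀ j : ℕ, 0 ≤ ((σ + a + 2 * j) ^ (k + 1))⁻¹ := fun j ↦ by positivity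
  have hsum : Summable (fun j : ℕ ↦ ((σ + a + 2 * j) ^ (k + 1))⁻¹) := by
    refine Summable.of_nonneg_of_le hnn (fun j ↦ ?_)
      Literature.Analysis.SpecialFunctions.Complex.summable_one_div_nat_add_one_sq
    have h1 : (j : ℝ) + 1 ≤ σ + a + 2 * j := by
      have : (0 : ℝ) ≤ j := Nat.cast_nonneg j
      linarith
    have h2 : ((j : ℝ) + 1) ^ 2 ≤ (σ + a + 2 * j) ^ (k + 1) :=
      calc ((j : ℝ) + 1) ^ 2 ≤ (σ + a + 2 * j) ^ 2 := pow_le_pow_left₀ (by positivity) h1 2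
        _ ≤ (σ + a + 2 * j) ^ (k + 1) := pow_le_pow_right₀ (by linarith) (by omega)
    rw [one_div]
    exact inv_anti₀ (by positivity) h2
  refine ⟨hsum, ?_, ?_⟩
  · rw [Complex.ofReal_tsum]
    refine tsum_congr fun j ↦ ?_
    push_cast; ring
  · have := hsum.le_tsum 0 (fun j _ ↦ hnn j)
    simpa using this

/-! ### §A.6 Lemma 3.1 in node form: the four-function family at a real point -/

/-- **Basak–Thorner–Zaharescu, Lemma 3.1 (node form).** Let `χ₁, χ₂, χ₃` be primitive characters `≠ 1` (to
moduli `q₁, q₂, q₃`) whose pair coefficients satisfy the NONNEGATIVITY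
`0 ≤ Re(2 + (χ₁+χ̄₁)(n) + (χ₂+χ̄₂)(n) + (χ₃+χ̄₃)(n))` for all `n` (for real characters this is
`2(1 + χ₁(n) + χ₂(n) + χ₃(n)) ≥ 0`, the print's `a_D(n) ≥ 0` for `D = ζ L(χ₁)L(χ₂)L(ψ)`), and let `D₀, D₁, D₂, D₃`
be the Hadamard data of `ξ, Ξ_{χ₁}, Ξ_{χ₂}, Ξ_{χ₃}`. Then at every real `σ > 1` and for every `k ≥ 1`, the
weighted full node sums `N_F(k,σ) = 2m_F(σ−½)^{−(k+1)} + Σₙ Zₙ^F(k,σ)` satisfy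

  `Re[2·N_ξ + N_{Ξ₁} + N_{Ξ₂} + N_{Ξ₃}] ≤ 2(σ − 1)^{−(k+1)}`.

(Printed: equate the `(kℓ−1)`-th derivative of the Dirichlet series of `−D'/D`, which has non-negative
coefficients, with that of its Hadamard expansion at `s = 1 + η`, and drop the series: «Since `a_D(n) ≥ 0`
uniformly, it follows that `Re Σ_ω (1+η−ω)^{−kℓ} < η^{−kℓ}`».) Here the trivial zeros are dropped as well (their
terms are positive reals), the pole of `ζ` gives the right side, and the factor `2` on `ξ` matches
`Ξ_χ = ξ(·,χ)ξ(·,χ̄)`. [cite: BasakThornerZaharescu2026, Lemma 3.1] -/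
theorem family_nodeSum_re_le
    {q₁ q₂ q₃ : ℕ} [NeZero q₁] [NeZero q₂] [NeZero q₃]
    {χ₁ : DirichletCharacter ℂ q₁} {χ₂ : DirichletCharacter ℂ q₂} {χ₃ : DirichletCharacter ℂ q₃}
    (hχ₁ : χ₁.IsPrimitive) (h₁ : χ₁ ≠ 1) (hχ₂ : χ₂.IsPrimitive) (h₂ : χ₂ ≠ 1)
    (hχ₃ : χ₃.IsPrimitive) (h₃ : χ₃ ≠ 1)
    (hcoef : ∀ n : ℕ, 0 ≤ ((2 : ℂ) + (χ₁ n + χ₁⁻¹ n) + (χ₂ n + χ₂⁻¹ n) + (χ₃ n + χ₃⁻¹ n)).re)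
    (D₀ : SymmHadamardData riemannXi) (D₁ : SymmHadamardData (xiPair χ₁))
    (D₂ : SymmHadamardData (xiPair χ₂)) (D₃ : SymmHadamardData (xiPair χ₃))
    {σ : ℝ} (hσ : 1 < σ) {k : ℕ} (hk : 1 ≤ k) :
    (2 * (2 * D₀.m * (((σ : ℂ) - 1 / 2) ^ (k + 1))⁻¹ + ∑' n, D₀.zeroTerm k σ n) +
      ((2 * D₁.m * (((σ : ℂ) - 1 / 2) ^ (k + 1))⁻¹ + ∑' n, D₁.zeroTerm k σ n) +
       (2 * D₂.m * (((σ : ℂ) - 1 / 2) ^ (k + 1))⁻¹ + ∑' n, D₂.zeroTerm k σ n) +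
       (2 * D₃.m * (((σ : ℂ) - 1 / 2) ^ (k + 1))⁻¹ + ∑' n, D₃.zeroTerm k σ n))).re ≤
      2 * ((σ - 1) ^ (k + 1))⁻¹ := by
  have hs : 1 < ((σ : ℂ)).re := by simpa using hσ
  -- the four explicit formulae
  have E0 := riemannXi_explicitFormula D₀ hs hk
  have E1 := xiPair_explicitFormula hχ₁ h₁ D₁ hs hk
  have E2 := xiPair_explicitFormula hχ₂ h₂ D₂ hs hk
  have E3 := xiPair_explicitFormula hχ₃ h₃ D₃ hs hk
  rw [mul_add, iteratedDeriv_LSeries_twist_eq χ₁ hs, iteratedDeriv_LSeries_twist_eq χ₁⁻¹ hs] at E1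
  rw [mul_add, iteratedDeriv_LSeries_twist_eq χ₂ hs, iteratedDeriv_LSeries_twist_eq χ₂⁻¹ hs] at E2
  rw [mul_add, iteratedDeriv_LSeries_twist_eq χ₃ hs, iteratedDeriv_LSeries_twist_eq χ₃⁻¹ hs] at E3
  rw [iteratedDeriv_LSeries_vonMangoldt_eq hs] at E0
  -- the trivial-zero sums are real
  obtain ⟨-, hG0, hG0le⟩ := trivialSum_eq_ofReal hσ le_rfl hk
  obtain ⟨-, hG1, -⟩ := trivialSum_eq_ofReal hσ (Nat.cast_nonneg (charParity χ₁)) hk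
  obtain ⟨-, hG2, -⟩ := trivialSum_eq_ofReal hσ (Nat.cast_nonneg (charParity χ₂)) hk
  obtain ⟨-, hG3, -⟩ := trivialSum_eq_ofReal hσ (Nat.cast_nonneg (charParity χ₃)) hk
  simp only [add_zero, Complex.ofReal_zero] at hG0 hG0le
  have hcast : ∀ χp : ℕ, (((σ : ℂ)) + (χp : ℂ)) = ((σ : ℂ) + ((χp : ℝ) : ℂ)) := fun χp ↦ by push_cast; ring
  rw [hcast (charParity χ₁)] at E1
  rw [hcast (charParity χ₂)] at E2
  rw [hcast (charParity χ₃)] at E3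
  rw [hG1] at E1
  rw [hG2] at E2
  rw [hG3] at E3
  rw [hG0] at E0
  set g0 : ℝ := ∑' j : ℕ, ((σ + 2 * j) ^ (k + 1))⁻¹ with hg0
  set g1 : ℝ := ∑' j : ℕ, ((σ + (charParity χ₁ : ℝ) + 2 * j) ^ (k + 1))⁻¹ with hg1
  set g2 : ℝ := ∑' j : ℕ, ((σ + (charParity χ₂ : ℝ) + 2 * j) ^ (k + 1))⁻¹ with hg2
  set g3 : ℝ := ∑' j : ℕ, ((σ + (charParity χ₃ : ℝ) + 2 * j) ^ (k + 1))⁻¹ with hg3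
  have hg1n : 0 ≤ g1 := tsum_nonneg fun j ↦ by positivity
  have hg2n : 0 ≤ g2 := tsum_nonneg fun j ↦ by positivity
  have hg3n : 0 ≤ g3 := tsum_nonneg fun j ↦ by positivity
  -- the Dirichlet side: `S = Σₙ c(n) w_k(n)` with `Re c(n) ≥ 0`
  set w : ℕ → ℝ := fun n ↦ Real.log n ^ k * Λ n / (n : ℝ) ^ σ with hw
  have hS : HasSum (fun n : ℕ ↦ ((2 : ℂ) + (χ₁ n + χ₁⁻¹ n) + (χ₂ n + χ₂⁻¹ n) + (χ₃ n + χ₃⁻¹ n)) * (w n : ℂ))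
      (2 * LSeries (LSeries.logMul^[k] ↗Λ) σ +
        ((LSeries (LSeries.logMul^[k] (↗χ₁ * ↗Λ)) σ + LSeries (LSeries.logMul^[k] (↗χ₁⁻¹ * ↗Λ)) σ) +
         (LSeries (LSeries.logMul^[k] (↗χ₂ * ↗Λ)) σ + LSeries (LSeries.logMul^[k] (↗χ₂⁻¹ * ↗Λ)) σ) +
         (LSeries (LSeries.logMul^[k] (↗χ₃ * ↗Λ)) σ + LSeries (LSeries.logMul^[k] (↗χ₃⁻¹ * ↗Λ)) σ))) := by
    have h0 := (hasSum_weight hσ k).mul_left (2 : ℂ)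
    have h1 := (hasSum_twist_weight χ₁ hσ k).add (hasSum_twist_weight χ₁⁻¹ hσ k)
    have h2 := (hasSum_twist_weight χ₂ hσ k).add (hasSum_twist_weight χ₂⁻¹ hσ k)
    have h3 := (hasSum_twist_weight χ₃ hσ k).add (hasSum_twist_weight χ₃⁻¹ hσ k)
    refine (h0.add ((h1.add h2).add h3)).congr_fun fun n ↦ ?_
    simp only [hw]
    ring
  set S : ℂ := 2 * LSeries (LSeries.logMul^[k] ↗Λ) σ +
        ((LSeries (LSeries.logMul^[k] (↗χ₁ * ↗Λ)) σ + LSeries (LSeries.logMul^[k] (↗χ₁⁻¹ * ↗Λ)) σ) +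
         (LSeries (LSeries.logMul^[k] (↗χ₂ * ↗Λ)) σ + LSeries (LSeries.logMul^[k] (↗χ₂⁻¹ * ↗Λ)) σ) +
         (LSeries (LSeries.logMul^[k] (↗χ₃ * ↗Λ)) σ + LSeries (LSeries.logMul^[k] (↗χ₃⁻¹ * ↗Λ)) σ)) with hSdef
  have hSre : 0 ≤ S.re := by
    refine HasSum.nonneg (fun n ↦ ?_) (Complex.hasSum_re hS)
    rw [Complex.mul_re, Complex.ofReal_re, Complex.ofReal_im, mul_zero, sub_zero]
    exact mul_nonneg (hcoef n) (weight_nonneg σ k n)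
  -- assemble
  have key : (2 * (2 * D₀.m * (((σ : ℂ) - 1 / 2) ^ (k + 1))⁻¹ + ∑' n, D₀.zeroTerm k σ n) +
      ((2 * D₁.m * (((σ : ℂ) - 1 / 2) ^ (k + 1))⁻¹ + ∑' n, D₁.zeroTerm k σ n) +
       (2 * D₂.m * (((σ : ℂ) - 1 / 2) ^ (k + 1))⁻¹ + ∑' n, D₂.zeroTerm k σ n) +
       (2 * D₃.m * (((σ : ℂ) - 1 / 2) ^ (k + 1))⁻¹ + ∑' n, D₃.zeroTerm k σ n))) =
      ((2 * ((σ - 1) ^ (k + 1))⁻¹ + 2 * (σ ^ (k + 1))⁻¹ - 2 * g0 - 2 * (g1 + g2 + g3) : ℝ) : ℂ) -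
        (((k.factorial : ℝ)⁻¹ : ℝ) : ℂ) * S := by
    have hfac : (((k.factorial : ℝ)⁻¹ : ℝ) : ℂ) = (k.factorial : ℂ)⁻¹ := by push_cast; ring
    rw [hfac, hSdef]
    push_cast
    linear_combination (2 : ℂ) * E0 + E1 + E2 + E3
  rw [key, Complex.sub_re, Complex.ofReal_re, Complex.re_ofReal_mul]
  have hfk : 0 ≤ (k.factorial : ℝ)⁻¹ := inv_nonneg.mpr (Nat.cast_nonneg _)
  nlinarith [mul_nonneg hfk hSre]


/-! ### §A.7 `a_D(n) ≥ 0` by characters (replaces «`D` is the Dedekind zeta function of a biquadratic field») -/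

section Coefficients

open DirichletCharacter

/-- A character lifted from level `m` to a multiple level `N` takes the value `χ(n)` at every natural number
`n` coprime to `N`. [folklore] -/
private theorem changeLevel_apply_natCast {m N : ℕ} [NeZero N] (hm : m ∣ N) (χ : DirichletCharacter ℂ m) {n : ℕ}
    (hn : n.Coprime N) : changeLevel hm χ n = χ n := by
  obtain ⟨u, hu⟩ := (ZMod.isUnit_iff_coprime n N).2 hn
  rw [← hu, changeLevel_eq_cast_of_dvd χ hm u, hu, ZMod.cast_natCast hm]

/-- A character vanishes at `n` when a prime divides both `n` and the level. [folklore] -/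
private theorem apply_natCast_eq_zero_of_prime_dvd {m : ℕ} [NeZero m] (χ : DirichletCharacter ℂ m) {p n : ℕ}
    (hp : p.Prime) (hpn : p ∣ n) (hpm : p ∣ m) : χ n = 0 := by
  refine MulChar.map_nonunit χ fun hu ↦ ?_
  rw [ZMod.isUnit_iff_coprime] at hu
  exact (Nat.not_coprime_of_dvd_of_dvd hp.one_lt hpn hpm) hu

/-- **The conductor lemma.** If `χ₁ (mod q₁)` is primitive, `χ₂ (mod q₂)` is quadratic, and `ψ (mod f)` induces
`χ₁χ₂` at a common level `N` (`χ₁', χ₂', ψ'` the lifts: `ψ' = χ₁'χ₂'`), then every prime `p ∣ q₁` with `p ∤ f`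
divides `q₂`: `χ₁' = ψ'·χ₂'` factors through `lcm(f, q₂)`, so `q₁ = cond χ₁' ∣ lcm(f, q₂)`
(Mathlib's `conductor_changeLevel`, `mem_conductorSet_iff_conductor_dvd`). This is the character-theoretic
content of «`p` ramifies in the biquadratic field». [folklore] -/
private theorem dvd_of_prime_dvd_of_not_dvd_conductor {q₁ q₂ f N : ℕ} [NeZero N]
    {χ₁ : DirichletCharacter ℂ q₁} {χ₂ : DirichletCharacter ℂ q₂} {ψ : DirichletCharacter ℂ f}
    (hχ₁ : χ₁.IsPrimitive) (hq₂ : χ₂.IsQuadratic) (h1 : q₁ ∣ N) (h2 : q₂ ∣ N) (hf : f ∣ N)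
    (hψ : changeLevel hf ψ = changeLevel h1 χ₁ * changeLevel h2 χ₂)
    {p : ℕ} (hp : p.Prime) (hp1 : p ∣ q₁) (hpf : ¬ p ∣ f) : p ∣ q₂ := by
  -- `χ₂'² = 1`, so `χ₁' = ψ' χ₂'`
  have hsq : changeLevel h2 χ₂ * changeLevel h2 χ₂ = 1 := by
    rw [← map_mul, ← pow_two, hq₂.sq_eq_one, map_one]
  have hχ₁' : changeLevel h1 χ₁ = changeLevel hf ψ * changeLevel h2 χ₂ := by
    rw [hψ, mul_assoc, hsq, mul_one]
  -- `χ₁'` factors through `d = lcm(f, q₂)`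
  set d : ℕ := Nat.lcm f q₂ with hd
  have hdN : d ∣ N := Nat.lcm_dvd hf h2
  have hfact : FactorsThrough (changeLevel h1 χ₁) d := by
    refine ⟨hdN, changeLevel (Nat.dvd_lcm_left f q₂) ψ * changeLevel (Nat.dvd_lcm_right f q₂) χ₂, ?_⟩
    rw [map_mul, ← changeLevel_trans, ← changeLevel_trans, hχ₁']
  have hcond : (changeLevel h1 χ₁).conductor ∣ d :=
    (mem_conductorSet_iff_conductor_dvd (changeLevel h1 χ₁) hdN).1 hfact
  rw [conductor_changeLevel χ₁ h1, (isPrimitive_def χ₁).1 hχ₁] at hcond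
  have hpd : p ∣ f * q₂ := (hp1.trans hcond).trans (Nat.lcm_dvd_mul f q₂)
  rcases (Nat.Prime.dvd_mul hp).1 hpd with h | h
  · exact absurd h hpf
  · exact h

/-- The real part of a value of a quadratic character is `0`, `1` or `−1`. [folklore] -/
private theorem re_apply_of_isQuadratic {m : ℕ} {χ : DirichletCharacter ℂ m} (hq : χ.IsQuadratic) (a : ZMod m) :
    (χ a).re = 0 ∨ (χ a).re = 1 ∨ (χ a).re = -1 := by
  rcases hq a with h | h | h <;> simp [h]

/-- **`a_D(n) ≥ 0` for `D = ζ·L(χ₁)·L(χ₂)·L(ψ)`** (Basak–Thorner–Zaharescu: «Since `D(s)` is the Dedekind zeta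
function of a biquadratic extension of `ℚ`, we have that `a_D(n) ≥ 0`»), proved by characters: for quadratic
characters `χ₁ (mod q₁)`, `χ₂ (mod q₂)`, BOTH primitive, and a quadratic `ψ (mod f)`, `f ∣ q₁q₂`, inducing
`χ₁χ₂` at level `q₁q₂`, the coefficient `1 + χ₁(n) + χ₂(n) + ψ(n)` of `−D'/D` (times `Λ(n)`) is `≥ 0` at
EVERY `n`: if `(n, q₁q₂) = 1` it is `(1 + χ₁(n))(1 + χ₂(n))`; if a prime `p ∣ (n, q₁q₂)` divides `f` then
`ψ(n) = 0` and one of `χ₁(n), χ₂(n)` vanishes; if `p ∤ f` then `p ∣ q₁` and `p ∣ q₂`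
(`dvd_of_prime_dvd_of_not_dvd_conductor`), so `χ₁(n) = χ₂(n) = 0`.
[cite: BasakThornerZaharescu2026, Lemma 3.1 (proof)] -/
theorem re_coeff_nonneg {q₁ q₂ f : ℕ} [NeZero q₁] [NeZero q₂] [NeZero f]
    {χ₁ : DirichletCharacter ℂ q₁} {χ₂ : DirichletCharacter ℂ q₂} {ψ : DirichletCharacter ℂ f}
    (hχ₁ : χ₁.IsPrimitive) (hχ₂ : χ₂.IsPrimitive) (hq₁ : χ₁.IsQuadratic) (hq₂ : χ₂.IsQuadratic)
    (hψq : ψ.IsQuadratic) (hf : f ∣ q₁ * q₂)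
    (hψ : @changeLevel ℂ _ f (q₁ * q₂) hf ψ =
      changeLevel (dvd_mul_right q₁ q₂) χ₁ * changeLevel (dvd_mul_left q₂ q₁) χ₂)
    (n : ℕ) : 0 ≤ (1 + χ₁ n + χ₂ n + ψ n).re := by
  have hN : NeZero (q₁ * q₂) := ⟨mul_ne_zero (NeZero.ne q₁) (NeZero.ne q₂)⟩
  simp only [Complex.add_re, Complex.one_re]
  by_cases hcop : n.Coprime (q₁ * q₂)
  · -- `ψ(n) = χ₁(n) χ₂(n)`
    have hψn : ψ n = χ₁ n * χ₂ n := by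
      have h := changeLevel_apply_natCast hf ψ hcop
      rw [hψ, MulChar.mul_apply, changeLevel_apply_natCast _ χ₁ hcop, changeLevel_apply_natCast _ χ₂ hcop] at h
      exact h.symm
    rw [hψn]
    rcases hq₁ (n : ZMod q₁) with h | h | h <;> rcases hq₂ (n : ZMod q₂) with h' | h' | h' <;>
      norm_num [h, h']
  · -- a prime `p` divides `n` and `q₁ q₂`
    have hg : Nat.gcd n (q₁ * q₂) ≠ 1 := hcop
    obtain ⟨p, hp, hpg⟩ := Nat.exists_prime_and_dvd hg
    have hpn : p ∣ n := hpg.trans (Nat.gcd_dvd_left _ _)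
    have hpN : p ∣ q₁ * q₂ := hpg.trans (Nat.gcd_dvd_right _ _)
    have h1re := re_apply_of_isQuadratic hq₁ (n : ZMod q₁)
    have h2re := re_apply_of_isQuadratic hq₂ (n : ZMod q₂)
    have hψre := re_apply_of_isQuadratic hψq (n : ZMod f)
    by_cases hpf : p ∣ f
    · have hψ0 : ψ n = 0 := apply_natCast_eq_zero_of_prime_dvd ψ hp hpn hpf
      rw [hψ0, Complex.zero_re, add_zero]
      rcases (Nat.Prime.dvd_mul hp).1 hpN with h | h
      · rw [apply_natCast_eq_zero_of_prime_dvd χ₁ hp hpn h, Complex.zero_re, add_zero]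
        rcases h2re with h' | h' | h' <;> rw [h'] <;> norm_num
      · rw [apply_natCast_eq_zero_of_prime_dvd χ₂ hp hpn h, Complex.zero_re, add_zero]
        rcases h1re with h' | h' | h' <;> rw [h'] <;> norm_num
    · -- `p ∤ f`: then `p ∣ q₁` and `p ∣ q₂`
      have hboth : p ∣ q₁ ∧ p ∣ q₂ := by
        rcases (Nat.Prime.dvd_mul hp).1 hpN with h | h
        · exact ⟨h, dvd_of_prime_dvd_of_not_dvd_conductor hχ₁ hq₂ _ _ hf hψ hp h hpf⟩
        · refine ⟨?_, h⟩
          have hψ' : @changeLevel ℂ _ f (q₁ * q₂) hf ψ =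
              changeLevel (dvd_mul_left q₂ q₁) χ₂ * changeLevel (dvd_mul_right q₁ q₂) χ₁ := by
            rw [hψ]; exact mul_comm _ _
          exact dvd_of_prime_dvd_of_not_dvd_conductor hχ₂ hq₁ _ _ hf hψ' hp h hpf
      rw [apply_natCast_eq_zero_of_prime_dvd χ₁ hp hpn hboth.1, apply_natCast_eq_zero_of_prime_dvd χ₂ hp hpn hboth.2,
        Complex.zero_re, add_zero, add_zero]
      rcases hψre with h' | h' | h' <;> rw [h'] <;> norm_num

end Coefficients


/-!
## Stage B: Lemma 3.2′ (the `K`-bound), Lemma 3.3 (the power sum), the endgame, and the discharge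

From here on we work at the printed point `σ = 1 + η` and split the Hadamard nodes of each factor into
REAL nodes (dropped by nonnegativity, except two copies of `β₁` resp. `β₂`) and NON-REAL nodes (the `z_j`,
`j ≥ 2`, of the printed power sum). [cite: BasakThornerZaharescu2026, §3 (between Lemmas 3.1 and 3.2)]
-/

/-! ### §B.1 Real and non-real nodes of a symmetric Hadamard datum -/

section Nodes

variable {F : ℂ → ℂ} (D : SymmHadamardData F)

/-- Every node of positive weight is a zero of `F` (`1 + cₙ(ρ − ½)² = 1 + cₙζₙ² = 0`).
[cite: Conway1978, Ch. XI Thm. 3.4] -/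
theorem apply_nodeVal_eq_zero {p : ℕ × Bool} (hp : D.c p.1 ≠ 0) : F (D.nodeVal p) = 0 := by
  by_contra h
  apply D.factor_ne_zero h p.1
  have hsq : (D.nodeVal p - 1 / 2) ^ 2 = D.node p.1 ^ 2 := by
    rcases p with ⟨n, b⟩
    cases b <;> simp [SymmHadamardData.nodeVal]
  rw [hsq]
  linear_combination D.c_mul_node_sq hp

/-- A REAL node `ρ` (one with `Im ρ = 0`) of positive weight gives a POSITIVE real term
`((σ − ρ)^{M})⁻¹ = ((σ − Re ρ)^M)⁻¹`, `σ − Re ρ ≥ σ − 1 > 0`. [folklore] -/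
private theorem node_term_of_im_eq_zero {p : ℕ × Bool} (hp : D.c p.1 ≠ 0) (him : (D.nodeVal p).im = 0)
    {σ : ℝ} (hσ : 1 < σ) (M : ℕ) :
    (D.nodeWt p : ℂ) * ((((σ : ℂ)) - D.nodeVal p) ^ M)⁻¹ = ((((σ - (D.nodeVal p).re) ^ M)⁻¹ : ℝ) : ℂ) ∧
      0 < ((σ - (D.nodeVal p).re) ^ M)⁻¹ := by
  have hw : D.nodeWt p = 1 := D.nodeWt_eq_one_iff.mpr hp
  have hre : (D.nodeVal p).re ≤ 1 := (D.nodeVal_re_mem hp).2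
  set r : ℝ := (D.nodeVal p).re with hr
  have hρ : D.nodeVal p = ((r : ℝ) : ℂ) := by
    apply Complex.ext <;> simp [hr, him]
  have hpos : 0 < σ - r := by linarith
  refine ⟨?_, by positivity⟩
  rw [hw, hρ]
  push_cast
  ring

/-- **Splitting the node sum into real and non-real nodes.** For `k ≥ 1`, real `σ > 1` with `F(σ) ≠ 0`, and
any finite set `P` of REAL nodes of positive weight:
`Σ_{p ∈ P} ((σ − Re ρ_p)^{k+1})⁻¹ + Re Σ'_{p non-real} w_p ((σ − ρ_p)^{k+1})⁻¹ ≤ Re Σₙ Zₙ(k, σ)`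
(all real-node terms are `≥ 0`; the non-real family is absolutely summable).
[cite: BasakThornerZaharescu2026, Lemma 3.1 (proof: «if `ω` is a real zero … `(1+η−ω)^{kℓ} ≥ 0`»)] -/
theorem sum_add_re_tsum_nonreal_le (hF : Differentiable ℂ F) {σ : ℝ} (hσ : 1 < σ) (hFσ : F σ ≠ 0)
    {k : ℕ} (hk : 1 ≤ k) (P : Finset (ℕ × Bool)) (hP : ∀ p ∈ P, D.c p.1 ≠ 0 ∧ (D.nodeVal p).im = 0) :
    Summable (fun p : ℕ × Bool ↦ if (D.nodeVal p).im = 0 then (0 : ℂ)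
      else (D.nodeWt p : ℂ) * ((((σ : ℂ)) - D.nodeVal p) ^ (k + 1))⁻¹) ∧
    ∑ p ∈ P, ((σ - (D.nodeVal p).re) ^ (k + 1))⁻¹ +
      (∑' p : ℕ × Bool, if (D.nodeVal p).im = 0 then (0 : ℂ)
        else (D.nodeWt p : ℂ) * ((((σ : ℂ)) - D.nodeVal p) ^ (k + 1))⁻¹).re ≤
      (∑' n, D.zeroTerm k σ n).re := by
  classical
  have hs : 1 < ((σ : ℂ)).re := by simpa using hσ
  set x : ℕ × Bool → ℂ := fun p ↦ (D.nodeWt p : ℂ) * ((((σ : ℂ)) - D.nodeVal p) ^ (k + 1))⁻¹ with hx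
  have hxs : Summable (fun p ↦ ‖x p‖) := D.summable_norm_nodeWt_mul_inv_pow hF hs hFσ hk
  have hxsum : HasSum x (∑' n, D.zeroTerm k σ n) := D.hasSum_nodeWt_mul_inv_pow hF hs hFσ hk
  set xr : ℕ × Bool → ℂ := fun p ↦ if (D.nodeVal p).im = 0 then x p else 0 with hxr
  set xn : ℕ × Bool → ℂ := fun p ↦ if (D.nodeVal p).im = 0 then 0 else x p with hxn
  have hxr_s : Summable xr := by
    refine Summable.of_norm_bounded hxs (fun p ↦ ?_)
    simp only [hxr]; split_ifs <;> simp
  have hxn_s : Summable xn := by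
    refine Summable.of_norm_bounded hxs (fun p ↦ ?_)
    simp only [hxn]; split_ifs <;> simp
  have hsplit : ∀ p, x p = xr p + xn p := fun p ↦ by
    simp only [hxr, hxn]; split_ifs <;> simp
  have htot : ∑' n, D.zeroTerm k σ n = ∑' p, xr p + ∑' p, xn p := by
    rw [← hxsum.tsum_eq, ← hxr_s.tsum_add hxn_s]
    exact tsum_congr hsplit
  -- the real-node part is a series of non-negative reals
  have hxr_re : ∀ p, 0 ≤ (xr p).re ∧ (p ∈ P → (xr p).re = ((σ - (D.nodeVal p).re) ^ (k + 1))⁻¹) := by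
    intro p
    by_cases hc : D.c p.1 = 0
    · have hw : D.nodeWt p = 0 := by simp [SymmHadamardData.nodeWt, hc]
      have : xr p = 0 := by simp only [hxr, hx, hw]; split_ifs <;> simp
      refine ⟨by rw [this]; simp, fun hpP ↦ absurd hc (hP p hpP).1⟩
    · by_cases him : (D.nodeVal p).im = 0
      · obtain ⟨heq, hpos⟩ := node_term_of_im_eq_zero D hc him hσ (k + 1)
        have : xr p = ((((σ - (D.nodeVal p).re) ^ (k + 1))⁻¹ : ℝ) : ℂ) := by
          simp only [hxr, if_pos him, hx]; exact heq
        rw [this, Complex.ofReal_re]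
        exact ⟨hpos.le, fun _ ↦ rfl⟩
      · have : xr p = 0 := by simp only [hxr, if_neg him]
        refine ⟨by rw [this]; simp, fun hpP ↦ absurd (hP p hpP).2 him⟩
  have hre_sum : HasSum (fun p ↦ (xr p).re) (∑' p, xr p).re := Complex.hasSum_re hxr_s.hasSum
  have hPle : ∑ p ∈ P, ((σ - (D.nodeVal p).re) ^ (k + 1))⁻¹ ≤ (∑' p, xr p).re := by
    have h := sum_le_hasSum P (fun p _ ↦ (hxr_re p).1) hre_sum
    refine le_trans (le_of_eq (Finset.sum_congr rfl fun p hp ↦ ((hxr_re p).2 hp).symm)) h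
  refine ⟨hxn_s, ?_⟩
  rw [htot, Complex.add_re]
  linarith

/-- **Non-real nodes far from `σ` contribute little in absolute value** (the input of Lemma 3.2′): if every
non-real node of positive weight has `‖σ − ρ‖ ≥ d > 0`, then for `ℓ ≥ 2`
`Σ'_{p non-real} w_p ‖((σ − ρ_p)^ℓ)⁻¹‖ ≤ d^{−(ℓ−2)} (σ − 1)⁻¹ Re Σₙ Zₙ(0, σ)`
(`‖σ−ρ‖^{−ℓ} ≤ d^{2−ℓ}‖σ−ρ‖^{−2}` and the order-2 `M`-bound `tsum_nodeWt_mul_norm_inv_sq_le`).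
[cite: ThornerZaman2017, Lemma 7.4] [cite: BasakThornerZaharescu2026, Lemma 3.2 (proof)] -/
theorem tsum_nonreal_norm_le (hF : Differentiable ℂ F) {σ : ℝ} (hσ : 1 < σ) (hFσ : F σ ≠ 0) {d : ℝ}
    (hd : 0 < d) (hfar : ∀ p : ℕ × Bool, D.c p.1 ≠ 0 → (D.nodeVal p).im ≠ 0 → d ≤ ‖((σ : ℂ)) - D.nodeVal p‖)
    {ℓ : ℕ} (hℓ : 2 ≤ ℓ) :
    Summable (fun p : ℕ × Bool ↦ (if (D.nodeVal p).im = 0 then (0 : ℝ) else D.nodeWt p) *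
      ‖((((σ : ℂ)) - D.nodeVal p) ^ ℓ)⁻¹‖) ∧
    ∑' p : ℕ × Bool, (if (D.nodeVal p).im = 0 then (0 : ℝ) else D.nodeWt p) *
        ‖((((σ : ℂ)) - D.nodeVal p) ^ ℓ)⁻¹‖ ≤
      (d ^ (ℓ - 2))⁻¹ * ((σ - 1)⁻¹ * (∑' n, D.zeroTerm 0 σ n).re) := by
  have hs : 1 < ((σ : ℂ)).re := by simpa using hσ
  have h2 := D.summable_nodeWt_mul_norm_inv_sq hF hs hFσ
  have hM := D.tsum_nodeWt_mul_norm_inv_sq_le hF hs hFσ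
  simp only [Complex.ofReal_re] at hM
  have hdl : 0 < (d ^ (ℓ - 2))⁻¹ := by positivity
  -- termwise comparison
  have hle : ∀ p : ℕ × Bool, (if (D.nodeVal p).im = 0 then (0 : ℝ) else D.nodeWt p) *
      ‖((((σ : ℂ)) - D.nodeVal p) ^ ℓ)⁻¹‖ ≤
      (d ^ (ℓ - 2))⁻¹ * (D.nodeWt p * ‖((((σ : ℂ)) - D.nodeVal p) ^ 2)⁻¹‖) := by
    intro p
    by_cases him : (D.nodeVal p).im = 0
    · rw [if_pos him, zero_mul]
      exact mul_nonneg hdl.le (mul_nonneg (D.nodeWt_nonneg p) (norm_nonneg _))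
    · rw [if_neg him]
      by_cases hc : D.c p.1 = 0
      · have hw : D.nodeWt p = 0 := by simp [SymmHadamardData.nodeWt, hc]
        simp [hw]
      · have hfar' := hfar p hc him
        have hpos : 0 < ‖((σ : ℂ)) - D.nodeVal p‖ := lt_of_lt_of_le hd hfar'
        obtain ⟨j, hj⟩ := Nat.exists_eq_add_of_le hℓ
        have key : ‖((((σ : ℂ)) - D.nodeVal p) ^ ℓ)⁻¹‖ ≤
            (d ^ (ℓ - 2))⁻¹ * ‖((((σ : ℂ)) - D.nodeVal p) ^ 2)⁻¹‖ := by
          rw [norm_inv, norm_inv, norm_pow, norm_pow, hj, show 2 + j - 2 = j by omega, pow_add, mul_inv,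
            mul_comm ((‖((σ : ℂ)) - D.nodeVal p‖ ^ 2)⁻¹)]
          exact mul_le_mul_of_nonneg_right (inv_anti₀ (pow_pos hd j) (pow_le_pow_left₀ hd.le hfar' j))
            (by positivity)
        calc D.nodeWt p * ‖((((σ : ℂ)) - D.nodeVal p) ^ ℓ)⁻¹‖
            ≤ D.nodeWt p * ((d ^ (ℓ - 2))⁻¹ * ‖((((σ : ℂ)) - D.nodeVal p) ^ 2)⁻¹‖) :=
              mul_le_mul_of_nonneg_left key (D.nodeWt_nonneg p)
          _ = (d ^ (ℓ - 2))⁻¹ * (D.nodeWt p * ‖((((σ : ℂ)) - D.nodeVal p) ^ 2)⁻¹‖) := by ring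
  have hnn : ∀ p : ℕ × Bool, 0 ≤ (if (D.nodeVal p).im = 0 then (0 : ℝ) else D.nodeWt p) *
      ‖((((σ : ℂ)) - D.nodeVal p) ^ ℓ)⁻¹‖ := fun p ↦ by
    split_ifs
    · simp
    · exact mul_nonneg (D.nodeWt_nonneg p) (norm_nonneg _)
  have hsum : Summable (fun p : ℕ × Bool ↦ (if (D.nodeVal p).im = 0 then (0 : ℝ) else D.nodeWt p) *
      ‖((((σ : ℂ)) - D.nodeVal p) ^ ℓ)⁻¹‖) := Summable.of_nonneg_of_le hnn hle (h2.mul_left _)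
  refine ⟨hsum, ?_⟩
  calc ∑' p : ℕ × Bool, (if (D.nodeVal p).im = 0 then (0 : ℝ) else D.nodeWt p) * ‖((((σ : ℂ)) - D.nodeVal p) ^ ℓ)⁻¹‖
      ≤ ∑' p : ℕ × Bool, (d ^ (ℓ - 2))⁻¹ * (D.nodeWt p * ‖((((σ : ℂ)) - D.nodeVal p) ^ 2)⁻¹‖) :=
        hsum.tsum_le_tsum hle (h2.mul_left _)
    _ = (d ^ (ℓ - 2))⁻¹ * ∑' p : ℕ × Bool, D.nodeWt p * ‖((((σ : ℂ)) - D.nodeVal p) ^ 2)⁻¹‖ := tsum_mul_left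
    _ ≤ (d ^ (ℓ - 2))⁻¹ * ((σ - 1)⁻¹ * (∑' n, D.zeroTerm 0 σ n).re) := by gcongr

/-- The order-`0` node sum is `F'/F(σ) − 2m/(σ − ½)`, hence `Re Σₙ Zₙ(0,σ) ≤ Re F'/F(σ)` at a real `σ > 1`.
[cite: Stark1974, Lemma 3] -/
theorem re_tsum_zeroTerm_zero_le (hF : Differentiable ℂ F) {σ : ℝ} (hσ : 1 < σ) (hFσ : F σ ≠ 0) :
    (∑' n, D.zeroTerm 0 σ n).re ≤ (logDeriv F σ).re := by
  have h := (D.hasSum_zeroTerm hF hFσ 0).tsum_eq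
  simp only [pow_zero, Nat.factorial_zero, Nat.cast_one, mul_one, inv_one, one_mul, iteratedDeriv_zero,
    zero_add, pow_one] at h
  rw [h, Complex.sub_re]
  have hm : 0 ≤ (2 * (D.m : ℂ) * (((σ : ℂ)) - 1 / 2)⁻¹).re := by
    have e : (2 * (D.m : ℂ) * (((σ : ℂ)) - 1 / 2)⁻¹) = ((2 * (D.m : ℝ) * (σ - 1 / 2)⁻¹ : ℝ) : ℂ) := by
      push_cast; ring
    rw [e, Complex.ofReal_re]
    have : 0 < σ - 1 / 2 := by linarith
    positivity
  linarith

end Nodes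

/-! ### §B.2 Order-0 bounds: `Re Ξ_χ'/Ξ_χ(σ) ≤ log q + 2 + 2/(σ−1)` and `Re ξ'/ξ(σ) ≤ 2 + 1/(σ−1)` -/

/-- `Re Γ_ℝ'/Γ_ℝ(1) ≤ 0` (`= −½log π − log 2 − γ/2`). [folklore] -/
private theorem re_logDeriv_Gammaℝ_one_nonpos : (logDeriv Gammaℝ (1 : ℂ)).re ≤ 0 := by
  rw [ExplicitPsiChar.logDeriv_Gammaℝ_one]
  have hπ : 0 ≤ Real.log Real.pi := Real.log_nonneg (by linarith [Real.pi_gt_three])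
  have h2 : 0 ≤ Real.log 2 := Real.log_nonneg (by norm_num)
  have hγ := Real.one_half_lt_eulerMascheroniConstant
  have e : (-(Real.log Real.pi : ℂ) / 2 - Real.log 2 - Real.eulerMascheroniConstant / 2) =
      ((-(Real.log Real.pi) / 2 - Real.log 2 - Real.eulerMascheroniConstant / 2 : ℝ) : ℂ) := by push_cast; ring
  rw [e, Complex.ofReal_re]
  linarith

/-- `Re Γ_ℝ'/Γ_ℝ(y) ≤ 1` for real `1 ≤ y ≤ 3`. [folklore] -/
private theorem re_logDeriv_Gammaℝ_ofReal_le_one {y : ℝ} (h1 : 1 ≤ y) (h3 : y ≤ 3) :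
    (logDeriv Gammaℝ (y : ℂ)).re ≤ 1 := by
  have h := Tafula2021.re_logDeriv_Gammaℝ_ofReal_sub_le_one (x := 1) le_rfl h1 (by linarith)
  have h0 := re_logDeriv_Gammaℝ_one_nonpos
  rw [Complex.ofReal_one] at h
  linarith

section Dirichlet

variable {q : ℕ} [NeZero q] {χ : DirichletCharacter ℂ q}

/-- **`Re Ξ_χ'/Ξ_χ(σ) ≤ log q + 2 + 2/(σ − 1)`** for real `1 < σ ≤ 2` (primitive `χ ≠ 1`):
`Re Ξ_χ'/Ξ_χ(σ) = log q + 2 Re Γ_ℝ'/Γ_ℝ(σ+κ) + 2 Re L'/L(σ,χ)` (`re_logDeriv_xiPair_ofReal`), with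
`Re Γ_ℝ'/Γ_ℝ ≤ 1` on `[1,3]` and `|Re L'/L(σ,χ)| < 1/(σ−1)`. [cite: BasakThornerZaharescu2026, Lemma 3.2 (proof)]
[cite: Tafula2021, Lemma 3.3 (proof)] -/
theorem re_logDeriv_xiPair_le (hχ : χ.IsPrimitive) (h1 : χ ≠ 1) {σ : ℝ} (hσ : 1 < σ) (hσ2 : σ ≤ 2) :
    (logDeriv (xiPair χ) σ).re ≤ Real.log q + 2 + 2 / (σ - 1) := by
  rw [Tafula2021.re_logDeriv_xiPair_ofReal hχ h1 hσ.le]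
  have hκ : (charParity χ : ℝ) ≤ 1 := by
    unfold charParity; split_ifs <;> norm_num
  have hκ0 : (0 : ℝ) ≤ charParity χ := Nat.cast_nonneg _
  have hΓ : (logDeriv Gammaℝ ((σ : ℂ) + charParity χ)).re ≤ 1 := by
    have e : ((σ : ℂ) + charParity χ) = (((σ + charParity χ : ℝ)) : ℂ) := by push_cast; ring
    rw [e]
    exact re_logDeriv_Gammaℝ_ofReal_le_one (by linarith) (by linarith)
  have hL := Tafula2021.abs_re_logDeriv_LFunction_ofReal_lt χ hσ hσ2
  have hL' := (abs_lt.1 hL).2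
  have : (2 : ℝ) / (σ - 1) = 2 * (1 / (σ - 1)) := by ring
  linarith

end Dirichlet

/-- **`Re ξ'/ξ(σ) ≤ 2 + 1/(σ − 1)`** for real `1 < σ ≤ 2`: `ξ'/ξ = 1/s + 1/(s−1) + Γ_ℝ'/Γ_ℝ − Σ Λ(n)n^{−s}`, the
last series being a non-negative real at `s = σ`. [cite: BasakThornerZaharescu2026, Lemma 3.2 (proof)] -/
theorem re_logDeriv_riemannXi_le {σ : ℝ} (hσ : 1 < σ) (hσ2 : σ ≤ 2) :
    (logDeriv riemannXi σ).re ≤ 2 + 1 / (σ - 1) := by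
  have hs : 1 < ((σ : ℂ)).re := by simpa using hσ
  rw [logDeriv_riemannXi_eq_of_one_lt_re hs]
  have hΛ : 0 ≤ (L ↗Λ (σ : ℂ)).re := by
    rw [DirichletZFR.LSeries_vonMangoldt_ofReal hσ, Complex.ofReal_re]
    exact tsum_nonneg fun n ↦ div_nonneg ArithmeticFunction.vonMangoldt_nonneg (Real.rpow_nonneg (Nat.cast_nonneg n) σ)
  have hΓ : (-(Real.log Real.pi : ℂ) / 2 + 1 / 2 * digamma ((σ : ℂ) / 2)).re ≤ 1 := by
    have h := re_logDeriv_Gammaℝ_ofReal_le_one hσ.le (by linarith)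
    rwa [LFunctions.logDeriv_Gammaℝ (half_ne_neg_nat_of_re_pos' (by simpa using (by linarith : 0 < σ))),
      ← Complex.ofReal_log Real.pi_pos.le, show digamma ((σ : ℂ) / 2) / 2 = 1 / 2 * digamma ((σ : ℂ) / 2) by ring] at h
  have h1 : ((1 : ℂ) / σ).re = 1 / σ := by
    rw [show (1 : ℂ) / σ = ((1 / σ : ℝ) : ℂ) by push_cast; ring, Complex.ofReal_re]
  have h2 : ((1 : ℂ) / (σ - 1)).re = 1 / (σ - 1) := by
    rw [show (1 : ℂ) / ((σ : ℂ) - 1) = ((1 / (σ - 1) : ℝ) : ℂ) by push_cast; ring, Complex.ofReal_re]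
  have h3 : 1 / σ ≤ 1 := by rw [div_le_one (by linarith)]; exact hσ.le
  rw [Complex.sub_re, Complex.add_re, Complex.add_re, h1, h2]
  linarith


/-! ### §B.3 The printed threshold `q₀ = exp(exp(10⁴/(δ³ε²)))`: the margins as kernel lemmas -/

section Margins

variable {δ₀ ε : ℝ}

/-- `10⁴/(δ³ε²) ≥ 10⁷`. [cite: BasakThornerZaharescu2026, §2 (2.1)] -/
theorem exponent_ge (hδ : 0 < δ₀) (hδ' : δ₀ < 1 / 10) (hε : 0 < ε) (hε1 : ε < 1) :
    (10 : ℝ) ^ 7 ≤ 10000 / (δ₀ ^ 3 * ε ^ 2) := by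
  rw [le_div_iff₀ (by positivity)]
  have h1 : δ₀ ^ 3 ≤ (1 / 10) ^ 3 := pow_le_pow_left₀ hδ.le hδ'.le 3
  have h2 : ε ^ 2 ≤ 1 := by nlinarith
  nlinarith [pow_pos hδ 3, pow_pos hε 2, mul_le_mul h1 h2 (sq_nonneg ε) (by positivity)]

/-- **Margin (i)**: `exp(−10⁴/(δ³ε)) < δε/1000`. This is why `(log q)^{−ε} ≤ (log q₀)^{−ε}` is below `δ/(2e)`
(the printed (2.5)–(2.7)) and below the final bound `(δ/e)(1 − e^{−ε/…})` (the printed contradiction between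
(finalbound) and (beta_j)). [cite: BasakThornerZaharescu2026, §2 (2.5)–(2.7) and §3 (finalbound)] -/
theorem exp_neg_exponent_lt (hδ : 0 < δ₀) (hδ' : δ₀ < 1 / 10) (hε : 0 < ε) :
    Real.exp (-(10000 / (δ₀ ^ 3 * ε))) < δ₀ * ε / 1000 := by
  have hx : 0 < 10000 / (δ₀ ^ 3 * ε) := by positivity
  -- `exp(x) > x ≥ 10⁶/(δε) > 1000/(δε)`
  have h1 : 10000 / (δ₀ ^ 3 * ε) < Real.exp (10000 / (δ₀ ^ 3 * ε)) := by
    linarith [Real.add_one_le_exp (10000 / (δ₀ ^ 3 * ε))]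
  have h2 : 1000 / (δ₀ * ε) ≤ 10000 / (δ₀ ^ 3 * ε) := by
    rw [div_le_div_iff₀ (by positivity) (by positivity)]
    have : δ₀ ^ 2 ≤ 1 / 100 := by nlinarith
    nlinarith [mul_pos hδ hε]
  rw [Real.exp_neg, inv_lt_comm₀ (Real.exp_pos _) (by positivity)]
  calc (δ₀ * ε / 1000)⁻¹ = 1000 / (δ₀ * ε) := by rw [inv_div]
    _ < Real.exp (10000 / (δ₀ ^ 3 * ε)) := lt_of_le_of_lt h2 h1

/-- `log 49608 ≤ 11`. [folklore] -/
private theorem log_49608_le : Real.log 49608 ≤ 11 := by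
  rw [Real.log_le_iff_le_exp (by norm_num)]
  have h := Real.exp_one_gt_d9
  have h11 : Real.exp 11 = Real.exp 1 ^ 11 := by rw [Real.exp_one_pow]; norm_num
  rw [h11]
  have : (49608 : ℝ) ≤ (2.7182818283 : ℝ) ^ 11 := by norm_num
  exact this.trans (pow_le_pow_left₀ (by norm_num) h.le 11)

/-- **Margin (ii)**: for `L₂ ≥ 10⁴/(δ³ε²)` (`L₂ = log log q₁ ≥ log log q₀`), `log(49608·L₂/δ) ≤ (ε/2)·L₂` — the
kernel form of the printed «It follows from (2.1), (2.2) and (2.7) that `ε > 2 log(1920 η⁻¹ log log q₁)/log log q₁`»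
with this file's constants (`1920 = 16·120` ↦ `2·106·39/ (δ/… )`). [cite: BasakThornerZaharescu2026, §3 (epsilon_range2)] -/
theorem log_margin (hδ : 0 < δ₀) (hδ' : δ₀ < 1 / 10) (hε : 0 < ε) (hε1 : ε < 1) {L₂ : ℝ}
    (hL : 10000 / (δ₀ ^ 3 * ε ^ 2) ≤ L₂) : Real.log (49608 * L₂ / δ₀) ≤ ε / 2 * L₂ := by
  have hΛ := exponent_ge hδ hδ' hε hε1
  have hL0 : 0 < L₂ := by linarith [pow_pos (by norm_num : (0:ℝ) < 10) 7]
  have hlog : Real.log (49608 * L₂ / δ₀) = Real.log 49608 + Real.log L₂ + Real.log δ₀⁻¹ := by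
    rw [div_eq_mul_inv, Real.log_mul (by positivity) (by positivity), Real.log_mul (by norm_num) hL0.ne']
  -- `log L₂ ≤ εL₂/4 + 4/ε − 2` and `log δ⁻¹ ≤ δ⁻¹ − 1`
  have h1 : Real.log L₂ ≤ ε / 4 * L₂ + (4 / ε - 1) - 1 := by
    have ha : 0 < ε / 4 * L₂ := by positivity
    have h := Real.log_le_sub_one_of_pos ha
    rw [Real.log_mul (by positivity) hL0.ne', Real.log_div hε.ne' (by norm_num)] at h
    have h4 : Real.log 4 - Real.log ε ≤ 4 / ε - 1 := by
      have := Real.log_le_sub_one_of_pos (show 0 < 4 / ε by positivity)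
      rwa [Real.log_div (by norm_num) hε.ne'] at this
    linarith
  have h2 : Real.log δ₀⁻¹ ≤ δ₀⁻¹ - 1 := Real.log_le_sub_one_of_pos (by positivity)
  have h3 := log_49608_le
  -- `8 + 4/ε + 1/δ ≤ εL₂/4`
  have h4 : 8 + 4 / ε + δ₀⁻¹ ≤ ε / 4 * L₂ := by
    have hmain : 8 + 4 / ε + δ₀⁻¹ ≤ ε / 4 * (10000 / (δ₀ ^ 3 * ε ^ 2)) := by
      have e1 : ε / 4 * (10000 / (δ₀ ^ 3 * ε ^ 2)) = 2500 * (δ₀⁻¹ ^ 3 * ε⁻¹) := by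
        field_simp; ring
      rw [e1, show (4 : ℝ) / ε = 4 * ε⁻¹ by ring]
      have ha : 10 ≤ δ₀⁻¹ := by
        rw [le_inv_comm₀ (by norm_num) hδ]; linarith
      have hb : 1 ≤ ε⁻¹ := one_le_inv_iff₀.mpr ⟨hε, hε1.le⟩
      have hab : δ₀⁻¹ ≤ δ₀⁻¹ ^ 3 * ε⁻¹ := by
        calc δ₀⁻¹ = δ₀⁻¹ * 1 * 1 := by ring
          _ ≤ δ₀⁻¹ * δ₀⁻¹ ^ 2 * ε⁻¹ := by gcongr; nlinarith
          _ = δ₀⁻¹ ^ 3 * ε⁻¹ := by ring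
      have hb' : ε⁻¹ ≤ δ₀⁻¹ ^ 3 * ε⁻¹ := by
        calc ε⁻¹ = 1 * ε⁻¹ := by ring
          _ ≤ δ₀⁻¹ ^ 3 * ε⁻¹ := by gcongr; exact one_le_pow₀ (by linarith)
      have h1' : 1 ≤ δ₀⁻¹ ^ 3 * ε⁻¹ := le_trans (by linarith) hab
      nlinarith
    exact hmain.trans (by gcongr)
  rw [hlog]
  linarith

/-- **Margin (iii)**: for `L ≥ exp(10⁴/(δ³ε²))` (`L = log q₁ ≥ log q₀`), `10 + 44/δ ≤ 3L` (the `K`-bound of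
Lemma 3.2′ needs `8η⁻¹ + 10 ≤ 3 log q₁`). [cite: BasakThornerZaharescu2026, §3 Lemma 3.2 (proof)] -/
theorem K_margin (hδ : 0 < δ₀) (hδ' : δ₀ < 1 / 10) (hε : 0 < ε) (hε1 : ε < 1) {L₁ : ℝ}
    (hL : Real.exp (10000 / (δ₀ ^ 3 * ε ^ 2)) ≤ L₁) : 10 + 44 / δ₀ ≤ 3 * L₁ := by
  have hΛ := exponent_ge hδ hδ' hε hε1
  have h1 : 10000 / (δ₀ ^ 3 * ε ^ 2) ≤ L₁ := by
    linarith [Real.add_one_le_exp (10000 / (δ₀ ^ 3 * ε ^ 2))]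
  have ha : 10 ≤ δ₀⁻¹ := by rw [le_inv_comm₀ (by norm_num) hδ]; linarith
  have hb : 1 ≤ ε⁻¹ := one_le_inv_iff₀.mpr ⟨hε, hε1.le⟩
  have e1 : 10000 / (δ₀ ^ 3 * ε ^ 2) = 10000 * (δ₀⁻¹ ^ 3 * ε⁻¹ ^ 2) := by field_simp
  rw [e1] at h1
  rw [show (44 : ℝ) / δ₀ = 44 * δ₀⁻¹ by ring]
  have h2 : δ₀⁻¹ ≤ δ₀⁻¹ ^ 3 * ε⁻¹ ^ 2 := by
    calc δ₀⁻¹ = δ₀⁻¹ * 1 * 1 := by ring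
      _ ≤ δ₀⁻¹ * δ₀⁻¹ ^ 2 * ε⁻¹ ^ 2 := by gcongr <;> nlinarith
      _ = δ₀⁻¹ ^ 3 * ε⁻¹ ^ 2 := by ring
  nlinarith

/-- **Margin (iv)**, the side condition of (2.7): `δε/1000 ≤ δ/(2e)`. [cite: BasakThornerZaharescu2026, §2 (2.7)] -/
theorem side_margin (hδ : 0 < δ₀) (hε : 0 < ε) (hε1 : ε < 1) :
    δ₀ * ε / 1000 ≤ δ₀ / (2 * Real.exp 1) := by
  have he := Real.exp_one_lt_d9
  rw [div_le_div_iff₀ (by norm_num) (by positivity)]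
  nlinarith [mul_pos hδ hε, Real.exp_pos 1]

end Margins

/-! ### §B.4 Threshold facts and the real zeros -/

/-- Above the threshold: `q₀ ≤ q` gives `exp(10⁴/(δ³ε²)) ≤ log q`, `1 < q`, and
`(log q)^{−ε} ≤ exp(−10⁴/(δ³ε))`. [cite: BasakThornerZaharescu2026, §2 (2.1)–(2.5)] -/
theorem threshold_facts {δ₀ ε : ℝ} (hδ : 0 < δ₀) (hε : 0 < ε) {q : ℕ} (hq : threshold δ₀ ε ≤ q) :
    Real.exp (10000 / (δ₀ ^ 3 * ε ^ 2)) ≤ Real.log q ∧ 1 < (q : ℝ) ∧ 1 < Real.log q ∧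
      Real.log q ^ (-ε) ≤ Real.exp (-(10000 / (δ₀ ^ 3 * ε))) := by
  have hq0 : 0 < (q : ℝ) := lt_of_lt_of_le (by unfold threshold; positivity) hq
  have h1 : Real.exp (10000 / (δ₀ ^ 3 * ε ^ 2)) ≤ Real.log q := by
    rw [Real.le_log_iff_exp_le hq0]; exact hq
  have hexp1 : 1 < Real.exp (10000 / (δ₀ ^ 3 * ε ^ 2)) := Real.one_lt_exp_iff.mpr (by positivity)
  have hlog1 : 1 < Real.log q := lt_of_lt_of_le hexp1 h1
  have hq1 : 1 < (q : ℝ) := by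
    by_contra h
    push Not at h
    have := Real.log_nonpos hq0.le h
    linarith
  refine ⟨h1, hq1, hlog1, ?_⟩
  have hlogpos : 0 < Real.log q := by linarith
  have h2 : 10000 / (δ₀ ^ 3 * ε ^ 2) ≤ Real.log (Real.log q) := by
    rw [Real.le_log_iff_exp_le hlogpos]; exact h1
  rw [Real.rpow_neg hlogpos.le, Real.exp_neg,
    inv_le_inv₀ (Real.rpow_pos_of_pos hlogpos ε) (Real.exp_pos _)]
  calc Real.exp (10000 / (δ₀ ^ 3 * ε)) = Real.exp (ε * (10000 / (δ₀ ^ 3 * ε ^ 2))) := by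
        congr 1; field_simp
    _ ≤ Real.exp (ε * Real.log (Real.log q)) := Real.exp_le_exp.mpr (by gcongr)
    _ = Real.log q ^ ε := by rw [Real.rpow_def_of_pos hlogpos, mul_comm]


/-- `‖1 − ρ‖ ≤ ‖σ − ρ‖` for real `σ ≥ 1` and `Re ρ ≤ 1`. [folklore] -/
private theorem norm_one_sub_le_norm_sub {σ : ℝ} (hσ : 1 ≤ σ) {ρ : ℂ} (hρ : ρ.re ≤ 1) :
    ‖(1 : ℂ) - ρ‖ ≤ ‖((σ : ℂ)) - ρ‖ := by
  rw [← sq_le_sq₀ (norm_nonneg _) (norm_nonneg _), Complex.sq_norm, Complex.sq_norm,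
    Complex.normSq_apply, Complex.normSq_apply]
  simp only [Complex.sub_re, Complex.one_re, Complex.ofReal_re, Complex.sub_im, Complex.one_im,
    Complex.ofReal_im, zero_sub]
  nlinarith

section Dirichlet

variable {q : ℕ} [NeZero q] {χ : DirichletCharacter ℂ q}

/-- For a REAL primitive character and a real zero `L(β, χ) = 0` with `0 < β < 1`, `β ≠ ½`: `β` is a multiple
zero of `Ξ_χ = ξ(·,χ)²`, so it is carried by TWO distinct Hadamard indices, each contributing the positive term
`((σ − β)^M)⁻¹` — the print's `1/(1+η−β_j)^{kℓ}` (for `j = 1, 2`). [cite: BasakThornerZaharescu2026, Lemma 3.1] -/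
theorem exists_two_real_nodes (hχ : χ.IsPrimitive) (h1 : χ ≠ 1) (hq : χ.IsQuadratic)
    (D : SymmHadamardData (xiPair χ)) {β : ℝ} (hβ0 : 0 < β) (hβ1 : β < 1) (hβh : β ≠ 1 / 2)
    (hL : χ.LFunction β = 0) :
    ∃ p₁ p₂ : ℕ × Bool, p₁ ≠ p₂ ∧ D.c p₁.1 ≠ 0 ∧ D.c p₂.1 ≠ 0 ∧
      D.nodeVal p₁ = (β : ℂ) ∧ D.nodeVal p₂ = (β : ℂ) := by
  have hξ : dirichletXi χ β = 0 := by
    rw [dirichletXi_eq_zero_iff_mem_charNontrivialZeros hχ h1,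
      ExplicitPsiChar.mem_charNontrivialZeros]
    exact ⟨hL, by simpa using hβ0, by simpa using hβ1⟩
  have hinv : χ⁻¹ = χ := hq.inv
  have hΞ : xiPair χ β = 0 ∧ deriv (xiPair χ) β = 0 := by
    have hfun : xiPair χ = dirichletXi χ * dirichletXi χ⁻¹ := rfl
    refine ⟨by rw [hfun, Pi.mul_apply, hξ, zero_mul], ?_⟩
    have hd := ((differentiable_dirichletXi h1 (β : ℂ)).hasDerivAt.mul
      (differentiable_dirichletXi (inv_ne_one.mpr h1) (β : ℂ)).hasDerivAt).deriv
    rw [hfun, hd, hinv, hξ]; ring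
  have hhalf : (β : ℂ) ≠ 1 / 2 := by
    intro h
    apply hβh
    have h' : ((β : ℝ) : ℂ) = ((1 / 2 : ℝ) : ℂ) := by rw [h]; norm_num
    exact Complex.ofReal_injective h'
  obtain ⟨n₁, n₂, hne, hn₁, hn₂⟩ := D.exists_two_indices_of_deriv_eq_zero hΞ.1 hΞ.2 hhalf
  obtain ⟨b₁, hb₁, -⟩ := D.nodeVal_pair_of_root hn₁
  obtain ⟨b₂, hb₂, -⟩ := D.nodeVal_pair_of_root hn₂
  have hc₁ : D.c n₁ ≠ 0 := by rintro h0; rw [h0, zero_mul] at hn₁; norm_num at hn₁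
  have hc₂ : D.c n₂ ≠ 0 := by rintro h0; rw [h0, zero_mul] at hn₂; norm_num at hn₂
  exact ⟨(n₁, b₁), (n₂, b₂), fun h ↦ hne (congrArg Prod.fst h), hc₁, hc₂, hb₁, hb₂⟩

/-- **`H_δ` keeps the non-real nodes of `Ξ_χ` at distance `≥ δ` from `σ`** (real primitive `χ ≠ 1`, `σ ≥ 1`):
a node of positive weight is a zero `ρ` of `L(s,χ)` or `L(s,χ̄) = L(s,χ)` with `0 < Re ρ < 1`; if it is not
real then `‖ρ − 1‖ ≥ δ` by `H_δ`, and `‖σ − ρ‖ ≥ ‖1 − ρ‖` as `σ ≥ 1 ≥ Re ρ`.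
[cite: BasakThornerZaharescu2026, §3 («`|1+η−ω| ≥ √(η²+δ²)`»)] -/
theorem nodes_far_xiPair {δ₀ : ℝ} (hH : LocalRealZeros δ₀) (hχ : χ.IsPrimitive) (h1 : χ ≠ 1)
    (hq : χ.IsQuadratic) (D : SymmHadamardData (xiPair χ)) {σ : ℝ} (hσ : 1 ≤ σ) (p : ℕ × Bool)
    (hp : D.c p.1 ≠ 0) (him : (D.nodeVal p).im ≠ 0) : δ₀ ≤ ‖((σ : ℂ)) - D.nodeVal p‖ := by
  set ρ := D.nodeVal p with hρ
  have hzero := apply_nodeVal_eq_zero D hp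
  have hfun : xiPair χ ρ = dirichletXi χ ρ * dirichletXi χ⁻¹ ρ := rfl
  rw [← hρ, hfun, mul_eq_zero, hq.inv, or_self] at hzero
  rw [dirichletXi_eq_zero_iff_mem_charNontrivialZeros hχ h1,
      ExplicitPsiChar.mem_charNontrivialZeros] at hzero
  obtain ⟨hLρ, hρ0, hρ1⟩ := hzero
  have hfar : δ₀ ≤ ‖ρ - 1‖ := by
    by_contra hlt
    push Not at hlt
    exact him (hH q χ hq hχ ρ hLρ hlt)
  calc δ₀ ≤ ‖ρ - 1‖ := hfar
    _ = ‖(1 : ℂ) - ρ‖ := by rw [norm_sub_rev]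
    _ ≤ ‖((σ : ℂ)) - ρ‖ := norm_one_sub_le_norm_sub hσ hρ1.le

end Dirichlet

/-- The trivial character mod `1` is primitive and quadratic; its `L`-function is `ζ`. [folklore] -/
private theorem one_level_one_facts :
    (1 : DirichletCharacter ℂ 1).IsPrimitive ∧ (1 : DirichletCharacter ℂ 1).IsQuadratic := by
  refine ⟨by rw [DirichletCharacter.isPrimitive_def, DirichletCharacter.conductor_one], fun a ↦ ?_⟩
  by_cases ha : IsUnit a
  · exact Or.inr (Or.inl (MulChar.one_apply ha))
  · exact Or.inl (MulChar.map_nonunit _ ha)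

/-- **`H_δ` keeps the non-real nodes of `ξ` (non-trivial zeros of `ζ`) at distance `≥ δ` from `σ`**
(`q = 1` in `𝒮`: `ζ` is `L(s, 1 mod 1)`; print: «The Riemann zeta function provably has no zero in this disk»,
here simply read off from `H_δ`). [cite: BasakThornerZaharescu2026, §2 (after (2.3))] -/
theorem nodes_far_riemannXi {δ₀ : ℝ} (hH : LocalRealZeros δ₀) (D : SymmHadamardData riemannXi) {σ : ℝ}
    (hσ : 1 ≤ σ) (p : ℕ × Bool) (hp : D.c p.1 ≠ 0) (him : (D.nodeVal p).im ≠ 0) :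
    δ₀ ≤ ‖((σ : ℂ)) - D.nodeVal p‖ := by
  set ρ := D.nodeVal p with hρ
  have hzero := apply_nodeVal_eq_zero D hp
  rw [← hρ, riemannXi_eq_zero_iff_holds ρ] at hzero
  obtain ⟨hζ, hρ0, hρ1⟩ := hzero
  have hL : (1 : DirichletCharacter ℂ 1).LFunction ρ = 0 := by
    rw [DirichletCharacter.LFunction_modOne_eq]; exact hζ
  have hfar : δ₀ ≤ ‖ρ - 1‖ := by
    by_contra hlt
    push Not at hlt
    exact him (hH 1 1 one_level_one_facts.2 one_level_one_facts.1 ρ hL hlt)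
  calc δ₀ ≤ ‖ρ - 1‖ := hfar
    _ = ‖(1 : ℂ) - ρ‖ := by rw [norm_sub_rev]
    _ ≤ ‖((σ : ℂ)) - ρ‖ := norm_one_sub_le_norm_sub hσ hρ1.le


/-! ### §B.5 The endgame inequalities (Lemma 3.4 and the last page of the print) -/

section Endgame

variable {δ₀ ε : ℝ}

/-- **Bernoulli step.** From `c ≤ η^{−M} − (η+u)^{−M}` (`u = 1 − β₁ > 0`): `c·η^M ≤ M·u/η`, via
`1 − a^M ≤ M(1−a)` for `a = η/(η+u) ∈ (0,1]` (the print's Lemma 3.4 «`ab > 1 − (1−a)^b`»).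
[cite: BasakThornerZaharescu2026, Lemma 3.4 and (Big-Oh Step)] -/
theorem bernoulli_step {η u c : ℝ} (hη : 0 < η) (hu : 0 < u) {M : ℕ}
    (h : c ≤ (η ^ M)⁻¹ - ((η + u) ^ M)⁻¹) : c * η ^ M ≤ M * u / η := by
  have hηu : 0 < η + u := by linarith
  set a := η / (η + u) with ha
  have ha1 : a ≤ 1 := by rw [ha, div_le_one hηu]; linarith
  have hB := one_add_mul_sub_le_pow (show (-1 : ℝ) ≤ a by rw [ha]; linarith [(by positivity : 0 ≤ η / (η + u))]) M
  have h1 : c * η ^ M ≤ 1 - a ^ M := by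
    have e : a ^ M = η ^ M * ((η + u) ^ M)⁻¹ := by rw [ha, div_pow, div_eq_mul_inv]
    have h' := mul_le_mul_of_nonneg_right h (pow_pos hη M).le
    rw [sub_mul, inv_mul_cancel₀ (pow_pos hη M).ne'] at h'
    rw [e]
    linarith
  have h3 : 1 - a = u / (η + u) := by rw [ha]; field_simp; ring
  have h4 : (M : ℝ) * (1 - a) ≤ M * u / η := by
    rw [h3, mul_div_assoc]
    exact mul_le_mul_of_nonneg_left (div_le_div_of_nonneg_left hu.le hη (by linarith)) (Nat.cast_nonneg M)
  linarith

/-- **The `ε`-margin step** (print: from `1−β₁ ≥ η(1920 log log q₁)^{−1}(log q₁)^{240 log(1−…)}` and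
`ε > 2 log(1920η^{−1} log log q₁)/log log q₁` to `β₂ ≤ 1 − (δ/e)(1 − e^{−ε/480})`), here with the constants
`106·39 = 4134`, `2·6·4134 = 49608`, `2·39·2 = 156`: if `(1/106)·v^M ≤ M·u/η` with `M ≤ 39ℓ`, `ℓ ≤ 2L₂`,
`u ≤ e^{−εL₂}`, `η ≥ δ/(2e)`, `0 < v ≤ 1` and `L₂ ≥ 10⁴/(δ³ε²)`, then `v ≤ 1 − ε/312`.
[cite: BasakThornerZaharescu2026, §3 (epsilon_range2)–(finalbound)] -/
theorem log_step (hδ : 0 < δ₀) (hδ' : δ₀ < 1 / 10) (hε : 0 < ε) (hε1 : ε < 1) {L₂ : ℝ}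
    (hL : 10000 / (δ₀ ^ 3 * ε ^ 2) ≤ L₂) {ℓ : ℕ} (hℓ2 : (ℓ : ℝ) ≤ 2 * L₂) {η u v : ℝ}
    (hη : δ₀ / (2 * Real.exp 1) ≤ η) (hu0 : 0 ≤ u) (hu : u ≤ Real.exp (-(ε * L₂))) (hv0 : 0 < v)
    (hv1 : v ≤ 1) {M : ℕ} (hM : (M : ℝ) ≤ 39 * ℓ) (h : 1 / 106 * v ^ M ≤ M * u / η) :
    v ≤ 1 - ε / 312 := by
  have hΛ := exponent_ge hδ hδ' hε hε1
  have hL0 : 0 < L₂ := by linarith [pow_pos (by norm_num : (0:ℝ) < 10) 7]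
  have he := Real.exp_one_lt_d9
  have he' := Real.exp_one_gt_d9
  have hη0 : 0 < η := lt_of_lt_of_le (by positivity) hη
  have hηinv : η⁻¹ ≤ 6 / δ₀ := by
    rw [inv_le_comm₀ hη0 (by positivity), inv_div]
    refine le_trans ?_ hη
    rw [div_le_div_iff₀ (by norm_num) (by positivity)]
    nlinarith
  -- `v^{39ℓ} ≤ v^M ≤ 106·39ℓ·u/η ≤ 49608·L₂/δ · e^{−εL₂} ≤ e^{−εL₂/2}`
  have hMn : M ≤ 39 * ℓ := by exact_mod_cast hM
  have h1 : v ^ (39 * ℓ) ≤ v ^ M := pow_le_pow_of_le_one hv0.le hv1 hMn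
  have h2 : v ^ (39 * ℓ) ≤ 4134 * ℓ * u * η⁻¹ := by
    have h' : (M : ℝ) * u / η ≤ 39 * ℓ * u / η := by gcongr
    have h'' : v ^ M ≤ 106 * (39 * ℓ * u / η) := by linarith
    calc v ^ (39 * ℓ) ≤ v ^ M := h1
      _ ≤ 106 * (39 * ℓ * u / η) := h''
      _ = 4134 * ℓ * u * η⁻¹ := by ring
  have h3 : 4134 * ℓ * u * η⁻¹ ≤ 49608 * L₂ / δ₀ * Real.exp (-(ε * L₂)) := by
    calc 4134 * ℓ * u * η⁻¹ ≤ 4134 * (2 * L₂) * Real.exp (-(ε * L₂)) * (6 / δ₀) := by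
          gcongr
      _ = 49608 * L₂ / δ₀ * Real.exp (-(ε * L₂)) := by ring
  have h4 : 49608 * L₂ / δ₀ ≤ Real.exp (ε / 2 * L₂) := by
    rw [← Real.log_le_iff_le_exp (by positivity)]
    exact log_margin hδ hδ' hε hε1 hL
  have h5 : v ^ (39 * ℓ) ≤ Real.exp (-(ε * L₂ / 2)) := by
    calc v ^ (39 * ℓ) ≤ 49608 * L₂ / δ₀ * Real.exp (-(ε * L₂)) := (h2.trans h3)
      _ ≤ Real.exp (ε / 2 * L₂) * Real.exp (-(ε * L₂)) := by gcongr
      _ = Real.exp (-(ε * L₂ / 2)) := by rw [← Real.exp_add]; ring_nf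
  -- logarithms
  have h6 : (39 * ℓ : ℕ) * Real.log v ≤ -(ε * L₂ / 2) := by
    rw [← Real.log_pow, Real.log_le_iff_le_exp (pow_pos hv0 _)]
    exact h5
  push_cast at h6
  have hlogv : Real.log v ≤ 0 := Real.log_nonpos hv0.le hv1
  have h7 : ε / 156 ≤ -Real.log v := by
    have key : 0 ≤ L₂ * (156 * (-Real.log v) - ε) := by
      have : (39 * (ℓ : ℝ)) * (-Real.log v) ≤ (78 * L₂) * (-Real.log v) :=
        mul_le_mul_of_nonneg_right (by linarith) (by linarith)
      nlinarith
    have := (mul_nonneg_iff_of_pos_left hL0).mp key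
    linarith
  have h8 : v ≤ Real.exp (-(ε / 156)) := by
    rw [← Real.exp_log hv0]
    exact Real.exp_le_exp.mpr (by linarith)
  have h9 : Real.exp (-(ε / 156)) ≤ 1 - ε / 312 := by
    rw [Real.exp_neg, inv_le_comm₀ (Real.exp_pos _) (by linarith), inv_eq_one_div,
      div_le_iff₀ (by linarith)]
    nlinarith [Real.add_one_le_exp (ε / 156), Real.exp_pos (ε / 156)]
  exact h8.trans h9

/-- **The `K`-step** (Lemma 3.2′ bookkeeping): with `R = 10 + 8/η + 4 log q₁` (the sum of the four order-0
bounds `2(2 + 1/η) + Σᵢ (log qᵢ + 2 + 2/η)`, `q₂ ≤ q₁`, `q_ψ ≤ q₁²`), `δ² R ≤ 4η e^ℓ` as soon as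
`10 + 44/δ ≤ 3 log q₁ ≤ 3e^ℓ` and `η ≥ δ/(2e)`, `δ < 1/10`. [cite: BasakThornerZaharescu2026, Lemma 3.2 (proof)] -/
theorem K_step (hδ : 0 < δ₀) (hδ' : δ₀ < 1 / 10) {η L₁ : ℝ} (hη : δ₀ / (2 * Real.exp 1) ≤ η)
    (hK : 10 + 44 / δ₀ ≤ 3 * L₁) {ℓ : ℕ} (hℓ : L₁ ≤ Real.exp 1 ^ ℓ) :
    δ₀ ^ 2 * (10 + 8 / η + 4 * L₁) ≤ 4 * η * Real.exp 1 ^ ℓ := by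
  have he := Real.exp_one_lt_d9
  have he' := Real.exp_one_gt_d9
  have hη0 : 0 < η := lt_of_lt_of_le (by positivity) hη
  have hL0 : 0 < L₁ := by
    have : 0 < 44 / δ₀ := by positivity
    linarith
  -- `8/η ≤ 16e/δ ≤ 44/δ`
  have h1 : 8 / η ≤ 44 / δ₀ := by
    rw [div_le_div_iff₀ hη0 hδ]
    have : δ₀ ≤ 2 * Real.exp 1 * η := by
      rwa [div_le_iff₀ (by positivity), mul_comm] at hη
    nlinarith
  have hR : 10 + 8 / η + 4 * L₁ ≤ 7 * L₁ := by linarith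
  -- `δ²·7L ≤ 4·(δ/(2e))·L ≤ 4ηe^ℓ`
  have h2 : δ₀ ^ 2 * (7 * L₁) ≤ 4 * (δ₀ / (2 * Real.exp 1)) * L₁ := by
    rw [show 4 * (δ₀ / (2 * Real.exp 1)) * L₁ = δ₀ * L₁ * (2 / Real.exp 1) by field_simp; ring]
    have h3 : δ₀ * 7 ≤ 2 / Real.exp 1 := by
      rw [le_div_iff₀ (Real.exp_pos 1)]; nlinarith
    nlinarith [mul_pos hδ hL0]
  calc δ₀ ^ 2 * (10 + 8 / η + 4 * L₁) ≤ δ₀ ^ 2 * (7 * L₁) := by gcongr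
    _ ≤ 4 * (δ₀ / (2 * Real.exp 1)) * L₁ := h2
    _ ≤ 4 * η * Real.exp 1 ^ ℓ := by gcongr

end Endgame

/-! ### §B.6 Packaging one Hadamard datum for the power sum -/

section Package

variable {F : ℂ → ℂ} (D : SymmHadamardData F)

/-- The `m`-term `2m(σ − ½)^{−M}` of the node sum is a non-negative real at a real `σ > ½`. [folklore] -/
private theorem m_term_re_nonneg {σ : ℝ} (hσ : 1 / 2 < σ) (M : ℕ) :
    0 ≤ (2 * (D.m : ℂ) * ((((σ : ℂ)) - 1 / 2) ^ M)⁻¹).re := by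
  have e : (2 * (D.m : ℂ) * ((((σ : ℂ)) - 1 / 2) ^ M)⁻¹) = ((2 * (D.m : ℝ) * ((σ - 1 / 2) ^ M)⁻¹ : ℝ) : ℂ) := by
    push_cast; ring
  rw [e, Complex.ofReal_re]
  have : 0 < σ - 1 / 2 := by linarith
  positivity

/-- **One factor of `D(s)` packaged for Turán's method.** With the weights `b_p = w_p·[ρ_p ∉ ℝ]` and the
points `z_p = (σ − ρ_p)^{−ℓ}` on the Hadamard nodes of `F` (`F = ξ` or `Ξ_χ`): the weights are `≥ 0`;
`Σ b_p‖z_p‖ ≤ d^{2−ℓ}(σ−1)^{−1}·B` whenever the non-real nodes are `d`-far from `σ` and `Re F'/F(σ) ≤ B`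
(Lemma 3.2′); `‖z_p‖ ≤ d^{−ℓ}` on the support; and for every `m ≥ 1` the `m`-th power sum is the non-real
part of the order-`mℓ` node sum, dominated together with any finite set of real nodes by `Re Σₙ Zₙ(mℓ−1, σ)`
(Lemma 3.1). [cite: BasakThornerZaharescu2026, §3 (definition of `z_j`), Lemmas 3.1–3.2] -/
theorem datum_package (hF : Differentiable ℂ F) {σ : ℝ} (hσ : 1 < σ) (hFσ : F σ ≠ 0) {d : ℝ} (hd : 0 < d)
    (hfar : ∀ p : ℕ × Bool, D.c p.1 ≠ 0 → (D.nodeVal p).im ≠ 0 → d ≤ ‖((σ : ℂ)) - D.nodeVal p‖)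
    {B : ℝ} (hB : (logDeriv F σ).re ≤ B) {ℓ : ℕ} (hℓ : 2 ≤ ℓ) :
    (∀ p : ℕ × Bool, 0 ≤ (if (D.nodeVal p).im = 0 then (0 : ℝ) else D.nodeWt p)) ∧
    Summable (fun p : ℕ × Bool ↦ (if (D.nodeVal p).im = 0 then (0 : ℝ) else D.nodeWt p) *
      ‖((((σ : ℂ)) - D.nodeVal p) ^ ℓ)⁻¹‖) ∧
    ∑' p : ℕ × Bool, (if (D.nodeVal p).im = 0 then (0 : ℝ) else D.nodeWt p) *
      ‖((((σ : ℂ)) - D.nodeVal p) ^ ℓ)⁻¹‖ ≤ (d ^ (ℓ - 2))⁻¹ * ((σ - 1)⁻¹ * B) ∧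
    (∀ p : ℕ × Bool, 0 < (if (D.nodeVal p).im = 0 then (0 : ℝ) else D.nodeWt p) →
      ‖((((σ : ℂ)) - D.nodeVal p) ^ ℓ)⁻¹‖ ≤ (d ^ ℓ)⁻¹) ∧
    (∀ m : ℕ, 1 ≤ m → ∀ P : Finset (ℕ × Bool), (∀ p ∈ P, D.c p.1 ≠ 0 ∧ (D.nodeVal p).im = 0) →
      Summable (fun p : ℕ × Bool ↦ ((if (D.nodeVal p).im = 0 then (0 : ℝ) else D.nodeWt p : ℝ) : ℂ) *
        (((((σ : ℂ)) - D.nodeVal p) ^ ℓ)⁻¹) ^ m) ∧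
      ∑ p ∈ P, ((σ - (D.nodeVal p).re) ^ (m * ℓ))⁻¹ +
        (∑' p : ℕ × Bool, ((if (D.nodeVal p).im = 0 then (0 : ℝ) else D.nodeWt p : ℝ) : ℂ) *
          (((((σ : ℂ)) - D.nodeVal p) ^ ℓ)⁻¹) ^ m).re ≤ (∑' n, D.zeroTerm (m * ℓ - 1) σ n).re) := by
  obtain ⟨hs1, hs2⟩ := tsum_nonreal_norm_le D hF hσ hFσ hd hfar hℓ
  have hZ0 := re_tsum_zeroTerm_zero_le D hF hσ hFσ
  refine ⟨fun p ↦ ?_, hs1, hs2.trans ?_, fun p hp ↦ ?_, fun m hm P hP ↦ ?_⟩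
  · split_ifs
    · exact le_rfl
    · exact D.nodeWt_nonneg p
  · have : 0 < σ - 1 := by linarith
    gcongr
    exact hZ0.trans hB
  · have hc : D.c p.1 ≠ 0 ∧ (D.nodeVal p).im ≠ 0 := by
      by_cases him : (D.nodeVal p).im = 0
      · rw [if_pos him] at hp; exact absurd hp (lt_irrefl 0)
      · rw [if_neg him] at hp
        exact ⟨D.nodeWt_eq_one_iff.mp (D.nodeWt_eq_one_of_pos hp), him⟩
    have hdp := hfar p hc.1 hc.2
    rw [norm_inv, norm_pow]
    exact inv_anti₀ (pow_pos hd ℓ) (pow_le_pow_left₀ hd.le hdp ℓ)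
  · have hMℓ : 1 ≤ m * ℓ - 1 := by
      have : 2 ≤ m * ℓ := le_trans (by omega) (Nat.mul_le_mul hm hℓ)
      omega
    have hM : m * ℓ - 1 + 1 = m * ℓ := by omega
    obtain ⟨hS, hle⟩ := sum_add_re_tsum_nonreal_le D hF hσ hFσ hMℓ P hP
    have hpt : (fun p : ℕ × Bool ↦ ((if (D.nodeVal p).im = 0 then (0 : ℝ) else D.nodeWt p : ℝ) : ℂ) *
        (((((σ : ℂ)) - D.nodeVal p) ^ ℓ)⁻¹) ^ m) = (fun p : ℕ × Bool ↦ if (D.nodeVal p).im = 0 then (0 : ℂ)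
        else (D.nodeWt p : ℂ) * ((((σ : ℂ)) - D.nodeVal p) ^ (m * ℓ - 1 + 1))⁻¹) := by
      funext p
      rw [hM, inv_pow, ← pow_mul']
      split_ifs <;> simp
    rw [hpt, hM] at *
    exact ⟨hS, by rw [hM] at hle; exact hle⟩

end Package

/-- Clearing denominators in the `K`-step: `δ²R ≤ 4ηE` gives `δ^{2−ℓ}η^{−1}R ≤ 4(δ^ℓ/E)^{−1}`. [folklore] -/
private theorem K_ratio {δ₀ η R E : ℝ} (hδ : 0 < δ₀) (hη : 0 < η) {ℓ : ℕ} (hℓ : 2 ≤ ℓ)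
    (h : δ₀ ^ 2 * R ≤ 4 * η * E) : (δ₀ ^ (ℓ - 2))⁻¹ * (η⁻¹ * R) ≤ 4 * (δ₀ ^ ℓ / E)⁻¹ := by
  obtain ⟨j, rfl⟩ := Nat.exists_eq_add_of_le hℓ
  rw [show 2 + j - 2 = j by omega, pow_add, inv_div]
  have h1 : η⁻¹ * R ≤ (δ₀ ^ 2)⁻¹ * (4 * E) := by
    rw [inv_mul_le_iff₀ hη, show η * ((δ₀ ^ 2)⁻¹ * (4 * E)) = (4 * η * E) / δ₀ ^ 2 by ring,
      le_div_iff₀ (by positivity)]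
    linarith
  calc (δ₀ ^ j)⁻¹ * (η⁻¹ * R) ≤ (δ₀ ^ j)⁻¹ * ((δ₀ ^ 2)⁻¹ * (4 * E)) := by gcongr
    _ = 4 * (E / (δ₀ ^ 2 * δ₀ ^ j)) := by field_simp

/-! ### §B.7 The power-sum step and the core contradiction (Lemmas 3.1–3.4 assembled at `σ = 1 + η`) -/

section Core

open DirichletCharacter

set_option maxHeartbeats 800000 in
-- the assembly of four Hadamard data into one power-sum family is long but elementary
/-- **Lemmas 3.1–3.3 assembled.** Under `H_δ`, for three primitive real characters `χ₁ (mod q₁)`,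
`χ₂ (mod q₂)`, `χ₃ = ψ (mod q₃)`, `χᵢ ≠ 1`, with `q₂ ≤ q₁`, `q₃ ≤ q₁q₂`, the Dedekind non-negativity
`Re(2 + Σᵢ(χᵢ + χ̄ᵢ))(n) ≥ 0`, `10 + 44/δ ≤ 3 log q₁ ≤ 3e^ℓ`, `η ≥ δ/(2e)`, `1 + η − β₂ = δ/e`, and real zeros
`β₁ ∈ (½,1)` of `L(s,χ₁)`, `β₂ ∈ (½,1)` of `L(s,χ₂)`: there is `1 ≤ m ≤ 39` with
`(1/106)(e/δ)^{mℓ} ≤ η^{−mℓ} − (1+η−β₁)^{−mℓ}` — the print's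
«`η^{−kℓ} − (1+η−β₁)^{−kℓ} ≥ (1/8)(1+η−β₂)^{−kℓ}`, `1 ≤ k ≤ 120`» with this file's constants. Ingredients:
Lemma 3.1 (`family_nodeSum_re_le` + the node split), Lemma 3.2′ (`datum_package` + `K_step`:
`Σ_j b_j|z_j|/(b₁|z₁|) ≤ 3`), Lemma 3.3 (Turán's second main theorem in the Kolesnikov–Straus form
`PowerSum.exists_re_tsum_powerSum_ge` with `ε' = 1`). [cite: BasakThornerZaharescu2026, Lemmas 3.1–3.3] -/
theorem powersum_step {δ₀ : ℝ} (hδ : 0 < δ₀) (hδ' : δ₀ < 1 / 10) (hH : LocalRealZeros δ₀)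
    {q₁ q₂ q₃ : ℕ} [NeZero q₁] [NeZero q₂] [NeZero q₃]
    {χ₁ : DirichletCharacter ℂ q₁} {χ₂ : DirichletCharacter ℂ q₂} {χ₃ : DirichletCharacter ℂ q₃}
    (hχ₁ : χ₁.IsPrimitive) (h₁ : χ₁ ≠ 1) (hq₁ : χ₁.IsQuadratic)
    (hχ₂ : χ₂.IsPrimitive) (h₂ : χ₂ ≠ 1) (hq₂ : χ₂.IsQuadratic)
    (hχ₃ : χ₃.IsPrimitive) (h₃ : χ₃ ≠ 1) (hq₃ : χ₃.IsQuadratic)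
    (hcoef : ∀ n : ℕ, 0 ≤ ((2 : ℂ) + (χ₁ n + χ₁⁻¹ n) + (χ₂ n + χ₂⁻¹ n) + (χ₃ n + χ₃⁻¹ n)).re)
    (hq₂₁ : q₂ ≤ q₁) (hq₃₁₂ : q₃ ≤ q₁ * q₂) (hK : 10 + 44 / δ₀ ≤ 3 * Real.log q₁)
    {ℓ : ℕ} (hℓ : 2 ≤ ℓ) (hexpℓ : Real.log q₁ ≤ Real.exp 1 ^ ℓ)
    {η β₁ β₂ : ℝ} (hηlo : δ₀ / (2 * Real.exp 1) ≤ η) (hβ₂η : 1 + η - β₂ = δ₀ / Real.exp 1)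
    (hβ₁1 : β₁ < 1) (hβ₁0 : 1 / 2 < β₁) (hβ₂1 : β₂ < 1) (hβ₂0 : 1 / 2 < β₂)
    (hL₁ : χ₁.LFunction β₁ = 0) (hL₂ : χ₂.LFunction β₂ = 0) :
    ∃ m : ℕ, 1 ≤ m ∧ (m : ℝ) ≤ 39 ∧
      1 / 106 * ((δ₀ / Real.exp 1) ^ (m * ℓ))⁻¹ ≤ (η ^ (m * ℓ))⁻¹ - ((η + (1 - β₁)) ^ (m * ℓ))⁻¹ := by
  classical
  have he := Real.exp_one_lt_d9
  have he' := Real.exp_one_gt_d9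
  -- ### `r = δ/e`, `σ = 1 + η`
  set r : ℝ := δ₀ / Real.exp 1 with hr_def
  have hr0 : 0 < r := by positivity
  have hr1 : r < 1 / 10 := by
    rw [hr_def, div_lt_iff₀ (Real.exp_pos 1)]; nlinarith only [hδ, hδ', he']
  have hη0 : 0 < η := lt_of_lt_of_le (by positivity) hηlo
  have hηr : η < r := by linarith only [hβ₂η, hβ₂1]
  set σ : ℝ := 1 + η with hσ_def
  have hσ1 : 1 < σ := by linarith only [hη0]
  have hσ2 : σ ≤ 2 := by linarith only [hηr, hr1]
  have hσβ₂ : σ - β₂ = r := by rw [hσ_def]; linarith only [hβ₂η]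
  have hσβ₁ : σ - β₁ = η + (1 - β₁) := by rw [hσ_def]; ring
  have hσ1' : σ - 1 = η := by rw [hσ_def]; ring
  have hEpos : 0 < Real.exp 1 ^ ℓ := pow_pos (Real.exp_pos 1) ℓ
  have hrℓ : r ^ ℓ = δ₀ ^ ℓ / Real.exp 1 ^ ℓ := by rw [hr_def, div_pow]
  have hlogq1 : 0 < Real.log q₁ := by
    have : 0 < 44 / δ₀ := by positivity
    linarith only [hK, this]
  -- ### Hadamard data and the four packages (`d = δ`)
  obtain ⟨D₀⟩ := nonempty_symmHadamardData_riemannXi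
  obtain ⟨D₁⟩ := nonempty_symmHadamardData_xiPair hχ₁ h₁
  obtain ⟨D₂⟩ := nonempty_symmHadamardData_xiPair hχ₂ h₂
  obtain ⟨D₃⟩ := nonempty_symmHadamardData_xiPair hχ₃ h₃
  have hs1c : 1 < ((σ : ℂ)).re := by simpa using hσ1
  obtain ⟨hb0, hsum0, hT0, hfar0, hpow0⟩ := datum_package D₀ differentiable_riemannXi hσ1
    (riemannXi_ne_zero_of_one_le_re hs1c.le) hδ (nodes_far_riemannXi hH D₀ hσ1.le)
    (re_logDeriv_riemannXi_le hσ1 hσ2) hℓ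
  obtain ⟨hb1, hsum1, hT1, hfar1, hpow1⟩ := datum_package D₁ (differentiable_xiPair h₁) hσ1
    (xiPair_ne_zero_of_one_lt_re hχ₁ h₁ hs1c) hδ (nodes_far_xiPair hH hχ₁ h₁ hq₁ D₁ hσ1.le)
    (re_logDeriv_xiPair_le hχ₁ h₁ hσ1 hσ2) hℓ
  obtain ⟨hb2, hsum2, hT2, hfar2, hpow2⟩ := datum_package D₂ (differentiable_xiPair h₂) hσ1
    (xiPair_ne_zero_of_one_lt_re hχ₂ h₂ hs1c) hδ (nodes_far_xiPair hH hχ₂ h₂ hq₂ D₂ hσ1.le)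
    (re_logDeriv_xiPair_le hχ₂ h₂ hσ1 hσ2) hℓ
  obtain ⟨hb3, hsum3, hT3, hfar3, hpow3⟩ := datum_package D₃ (differentiable_xiPair h₃) hσ1
    (xiPair_ne_zero_of_one_lt_re hχ₃ h₃ hs1c) hδ (nodes_far_xiPair hH hχ₃ h₃ hq₃ D₃ hσ1.le)
    (re_logDeriv_xiPair_le hχ₃ h₃ hσ1 hσ2) hℓ
  -- ### `z₁ = (σ − β₂)^{−ℓ} = r^{−ℓ}`
  set z₀ : ℂ := ((((σ : ℂ)) - (β₂ : ℂ)) ^ ℓ)⁻¹ with hz₀_def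
  have hz₀r : z₀ = ((((r ^ ℓ)⁻¹ : ℝ)) : ℂ) := by
    rw [hz₀_def, ← Complex.ofReal_sub, hσβ₂]; push_cast; rfl
  have hρ0 : 0 < (r ^ ℓ)⁻¹ := by positivity
  have hz₀norm : ‖z₀‖ = (r ^ ℓ)⁻¹ := by
    rw [hz₀r, Complex.norm_real, Real.norm_of_nonneg hρ0.le]
  have hz₀ne : z₀ ≠ 0 := by
    rw [← norm_pos_iff, hz₀norm]; exact hρ0
  have hδℓ : (δ₀ ^ ℓ)⁻¹ ≤ (r ^ ℓ)⁻¹ := by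
    refine inv_anti₀ (pow_pos hr0 ℓ) (pow_le_pow_left₀ hr0.le ?_ ℓ)
    rw [hr_def, div_le_iff₀ (Real.exp_pos 1)]
    exact le_mul_of_one_le_right hδ.le (by linarith only [he'])
  -- ### the family `(b_j, z_j)` of the power sum
  set b : Unit ⊕ ((ℕ × Bool) ⊕ ((ℕ × Bool) ⊕ ((ℕ × Bool) ⊕ (ℕ × Bool)))) → ℝ :=
    Sum.elim (fun _ ↦ 2)
      (Sum.elim (fun p ↦ 2 * (if (D₀.nodeVal p).im = 0 then (0 : ℝ) else D₀.nodeWt p))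
        (Sum.elim (fun p ↦ if (D₁.nodeVal p).im = 0 then (0 : ℝ) else D₁.nodeWt p)
          (Sum.elim (fun p ↦ if (D₂.nodeVal p).im = 0 then (0 : ℝ) else D₂.nodeWt p)
            (fun p ↦ if (D₃.nodeVal p).im = 0 then (0 : ℝ) else D₃.nodeWt p)))) with hb_def
  set z : Unit ⊕ ((ℕ × Bool) ⊕ ((ℕ × Bool) ⊕ ((ℕ × Bool) ⊕ (ℕ × Bool)))) → ℂ :=
    Sum.elim (fun _ ↦ z₀)
      (Sum.elim (fun p ↦ ((((σ : ℂ)) - D₀.nodeVal p) ^ ℓ)⁻¹)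
        (Sum.elim (fun p ↦ ((((σ : ℂ)) - D₁.nodeVal p) ^ ℓ)⁻¹)
          (Sum.elim (fun p ↦ ((((σ : ℂ)) - D₂.nodeVal p) ^ ℓ)⁻¹)
            (fun p ↦ ((((σ : ℂ)) - D₃.nodeVal p) ^ ℓ)⁻¹)))) with hz_def
  have hbj : b (Sum.inl ()) = 2 := rfl
  have hzj : z (Sum.inl ()) = z₀ := rfl
  have hb_nonneg : ∀ j, 0 ≤ b j := by
    rintro (u | p | p | p | p) <;> simp only [hb_def, Sum.elim_inl, Sum.elim_inr]
    · norm_num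
    · exact mul_nonneg zero_le_two (hb0 p)
    · exact hb1 p
    · exact hb2 p
    · exact hb3 p
  have hmax : ∀ j, 0 < b j → ‖z j‖ ≤ ‖z (Sum.inl ())‖ := by
    rintro (u | p | p | p | p) hp <;>
      simp only [hb_def, hz_def, Sum.elim_inl, Sum.elim_inr, hz₀norm] at hp ⊢
    · exact le_rfl
    · exact (hfar0 p (pos_of_mul_pos_right hp zero_le_two)).trans hδℓ
    · exact (hfar1 p hp).trans hδℓ
    · exact (hfar2 p hp).trans hδℓ
    · exact (hfar3 p hp).trans hδℓ
  -- `Σ_j b_j‖z_j‖ = 2 r^{−ℓ} + 2T₀ + T₁ + T₂ + T₃`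
  set T₀ := ∑' p : ℕ × Bool, (if (D₀.nodeVal p).im = 0 then (0 : ℝ) else D₀.nodeWt p) *
    ‖((((σ : ℂ)) - D₀.nodeVal p) ^ ℓ)⁻¹‖ with hT₀_def
  set T₁ := ∑' p : ℕ × Bool, (if (D₁.nodeVal p).im = 0 then (0 : ℝ) else D₁.nodeWt p) *
    ‖((((σ : ℂ)) - D₁.nodeVal p) ^ ℓ)⁻¹‖ with hT₁_def
  set T₂ := ∑' p : ℕ × Bool, (if (D₂.nodeVal p).im = 0 then (0 : ℝ) else D₂.nodeWt p) *
    ‖((((σ : ℂ)) - D₂.nodeVal p) ^ ℓ)⁻¹‖ with hT₂_def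
  set T₃ := ∑' p : ℕ × Bool, (if (D₃.nodeVal p).im = 0 then (0 : ℝ) else D₃.nodeWt p) *
    ‖((((σ : ℂ)) - D₃.nodeVal p) ^ ℓ)⁻¹‖ with hT₃_def
  have c0 : HasSum (fun _ : Unit ↦ (2 : ℝ) * ‖z₀‖) (2 * ‖z₀‖) := by simp
  have c1 : HasSum (fun p : ℕ × Bool ↦ 2 * (if (D₀.nodeVal p).im = 0 then (0 : ℝ) else D₀.nodeWt p) *
      ‖((((σ : ℂ)) - D₀.nodeVal p) ^ ℓ)⁻¹‖) (2 * T₀) := by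
    simpa only [mul_assoc] using hsum0.hasSum.mul_left 2
  have hHS : HasSum (fun j ↦ b j * ‖z j‖) (2 * ‖z₀‖ + (2 * T₀ + (T₁ + (T₂ + T₃)))) :=
    HasSum.sum c0 (HasSum.sum c1 (HasSum.sum hsum1.hasSum (HasSum.sum hsum2.hasSum hsum3.hasSum)))
  -- ### Lemma 3.2′: the ratio is `≤ 3`
  have hq₂₁r : (q₂ : ℝ) ≤ q₁ := by exact_mod_cast hq₂₁
  have hq1pos : 0 < (q₁ : ℝ) := Nat.cast_pos.mpr (NeZero.pos q₁)
  have hq2pos : 0 < (q₂ : ℝ) := Nat.cast_pos.mpr (NeZero.pos q₂)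
  have hq3pos : 0 < (q₃ : ℝ) := Nat.cast_pos.mpr (NeZero.pos q₃)
  have hq2log : Real.log q₂ ≤ Real.log q₁ := Real.log_le_log hq2pos hq₂₁r
  have hq3log : Real.log q₃ ≤ 2 * Real.log q₁ := by
    have : (q₃ : ℝ) ≤ q₁ * q₂ := by exact_mod_cast hq₃₁₂
    calc Real.log q₃ ≤ Real.log (q₁ * q₂) := Real.log_le_log hq3pos this
      _ = Real.log q₁ + Real.log q₂ := Real.log_mul hq1pos.ne' hq2pos.ne'
      _ ≤ 2 * Real.log q₁ := by linarith only [hq2log]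
  have hKs := K_step hδ hδ' hηlo hK hexpℓ
  have hKr := K_ratio (R := 10 + 8 / η + 4 * Real.log q₁) hδ hη0 hℓ hKs
  rw [← hrℓ] at hKr
  have hTsum : 2 * T₀ + (T₁ + (T₂ + T₃)) ≤ 4 * (r ^ ℓ)⁻¹ := by
    rw [hσ1'] at hT0 hT1 hT2 hT3
    have hd0 : 0 ≤ (δ₀ ^ (ℓ - 2))⁻¹ := by positivity
    have e : 2 * ((δ₀ ^ (ℓ - 2))⁻¹ * (η⁻¹ * (2 + 1 / η))) + ((δ₀ ^ (ℓ - 2))⁻¹ * (η⁻¹ * (Real.log q₁ + 2 + 2 / η)) +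
        ((δ₀ ^ (ℓ - 2))⁻¹ * (η⁻¹ * (Real.log q₂ + 2 + 2 / η)) +
          (δ₀ ^ (ℓ - 2))⁻¹ * (η⁻¹ * (Real.log q₃ + 2 + 2 / η)))) =
        (δ₀ ^ (ℓ - 2))⁻¹ * (η⁻¹ * (10 + 8 / η + (Real.log q₁ + Real.log q₂ + Real.log q₃))) := by
      ring
    have hmono : (δ₀ ^ (ℓ - 2))⁻¹ * (η⁻¹ * (10 + 8 / η + (Real.log q₁ + Real.log q₂ + Real.log q₃))) ≤
        (δ₀ ^ (ℓ - 2))⁻¹ * (η⁻¹ * (10 + 8 / η + 4 * Real.log q₁)) := by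
      gcongr; linarith only [hq2log, hq3log]
    linarith only [hT0, hT1, hT2, hT3, e, hmono, hKr]
  have hS3 : (∑' j, b j * ‖z j‖) / (b (Sum.inl ()) * ‖z (Sum.inl ())‖) ≤ 3 := by
    rw [hHS.tsum_eq, hbj, hzj, hz₀norm, div_le_iff₀ (by positivity)]
    linarith only [hTsum, hρ0]
  -- ### Lemma 3.3: Turán's power sum
  obtain ⟨m, hm1, hmK, hre, -⟩ := PowerSum.exists_re_tsum_powerSum_ge z b hb_nonneg hHS.summable
    (j₀ := Sum.inl ()) (by rw [hbj]; norm_num) (by rw [hzj]; exact hz₀ne) hmax one_pos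
  have hm39 : (m : ℝ) ≤ 39 := by
    calc (m : ℝ) ≤ (12 + 1) * ((∑' j, b j * ‖z j‖) / (b (Sum.inl ()) * ‖z (Sum.inl ())‖)) := hmK
      _ ≤ (12 + 1) * 3 := by gcongr
      _ = 39 := by norm_num
  refine ⟨m, hm1, hm39, ?_⟩
  -- the real nodes `β₁` (of `Ξ_{χ₁}`) and `β₂` (of `Ξ_{χ₂}`), each twice
  obtain ⟨p₁, p₁', hne₁, hc₁, hc₁', hv₁, hv₁'⟩ := exists_two_real_nodes hχ₁ h₁ hq₁ D₁ (by linarith only [hβ₁0])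
    hβ₁1 (by intro h; rw [h] at hβ₁0; exact lt_irrefl _ hβ₁0) hL₁
  obtain ⟨p₂, p₂', hne₂, hc₂, hc₂', hv₂, hv₂'⟩ := exists_two_real_nodes hχ₂ h₂ hq₂ D₂ (by linarith only [hβ₂0])
    hβ₂1 (by intro h; rw [h] at hβ₂0; exact lt_irrefl _ hβ₂0) hL₂
  have hP₁ : ∀ p ∈ ({p₁, p₁'} : Finset (ℕ × Bool)), D₁.c p.1 ≠ 0 ∧ (D₁.nodeVal p).im = 0 := by
    intro p hp
    simp only [Finset.mem_insert, Finset.mem_singleton] at hp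
    rcases hp with rfl | rfl
    · exact ⟨hc₁, by rw [hv₁, Complex.ofReal_im]⟩
    · exact ⟨hc₁', by rw [hv₁', Complex.ofReal_im]⟩
  have hP₂ : ∀ p ∈ ({p₂, p₂'} : Finset (ℕ × Bool)), D₂.c p.1 ≠ 0 ∧ (D₂.nodeVal p).im = 0 := by
    intro p hp
    simp only [Finset.mem_insert, Finset.mem_singleton] at hp
    rcases hp with rfl | rfl
    · exact ⟨hc₂, by rw [hv₂, Complex.ofReal_im]⟩
    · exact ⟨hc₂', by rw [hv₂', Complex.ofReal_im]⟩
  obtain ⟨hN0s, hN0⟩ := hpow0 m hm1 ∅ (by simp)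
  obtain ⟨hN1s, hN1⟩ := hpow1 m hm1 {p₁, p₁'} hP₁
  obtain ⟨hN2s, hN2⟩ := hpow2 m hm1 {p₂, p₂'} hP₂
  obtain ⟨hN3s, hN3⟩ := hpow3 m hm1 ∅ (by simp)
  rw [Finset.sum_empty, zero_add] at hN0 hN3
  rw [Finset.sum_pair hne₁, hv₁, hv₁', Complex.ofReal_re, hσβ₁] at hN1
  rw [Finset.sum_pair hne₂, hv₂, hv₂', Complex.ofReal_re, hσβ₂] at hN2
  set N₀ := ∑' p : ℕ × Bool, ((if (D₀.nodeVal p).im = 0 then (0 : ℝ) else D₀.nodeWt p : ℝ) : ℂ) *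
    (((((σ : ℂ)) - D₀.nodeVal p) ^ ℓ)⁻¹) ^ m with hN₀_def
  set N₁ := ∑' p : ℕ × Bool, ((if (D₁.nodeVal p).im = 0 then (0 : ℝ) else D₁.nodeWt p : ℝ) : ℂ) *
    (((((σ : ℂ)) - D₁.nodeVal p) ^ ℓ)⁻¹) ^ m with hN₁_def
  set N₂ := ∑' p : ℕ × Bool, ((if (D₂.nodeVal p).im = 0 then (0 : ℝ) else D₂.nodeWt p : ℝ) : ℂ) *
    (((((σ : ℂ)) - D₂.nodeVal p) ^ ℓ)⁻¹) ^ m with hN₂_def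
  set N₃ := ∑' p : ℕ × Bool, ((if (D₃.nodeVal p).im = 0 then (0 : ℝ) else D₃.nodeWt p : ℝ) : ℂ) *
    (((((σ : ℂ)) - D₃.nodeVal p) ^ ℓ)⁻¹) ^ m with hN₃_def
  -- `Σ_j b_j z_j^m = 2 z₁^m + 2N₀ + N₁ + N₂ + N₃`
  have d0 : HasSum (fun _ : Unit ↦ (((2 : ℝ)) : ℂ) * z₀ ^ m) (2 * z₀ ^ m) := by simp
  have d1 : HasSum (fun p : ℕ × Bool ↦
      (((2 * (if (D₀.nodeVal p).im = 0 then (0 : ℝ) else D₀.nodeWt p) : ℝ)) : ℂ) *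
        (((((σ : ℂ)) - D₀.nodeVal p) ^ ℓ)⁻¹) ^ m) (2 * N₀) :=
    (hN0s.hasSum.mul_left (2 : ℂ)).congr_fun fun p ↦ by
      rw [Complex.ofReal_mul, Complex.ofReal_ofNat, mul_assoc]
  have hG : HasSum (fun j ↦ (b j : ℂ) * z j ^ m) (2 * z₀ ^ m + (2 * N₀ + (N₁ + (N₂ + N₃)))) :=
    HasSum.sum d0 (HasSum.sum d1 (HasSum.sum hN1s.hasSum (HasSum.sum hN2s.hasSum hN3s.hasSum)))
  rw [hG.tsum_eq, hbj, hzj, hz₀norm] at hre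
  -- ### Lemma 3.1 at order `M = mℓ`
  have hMℓ : 1 ≤ m * ℓ - 1 := by
    have : 2 ≤ m * ℓ := le_trans (by omega) (Nat.mul_le_mul hm1 hℓ)
    omega
  have hM : m * ℓ - 1 + 1 = m * ℓ := by omega
  have hfam := family_nodeSum_re_le hχ₁ h₁ hχ₂ h₂ hχ₃ h₃ hcoef D₀ D₁ D₂ D₃ hσ1 hMℓ
  rw [hM, hσ1'] at hfam
  have hm0 := m_term_re_nonneg D₀ (by linarith only [hσ1] : 1 / 2 < σ) (m * ℓ)
  have hm1' := m_term_re_nonneg D₁ (by linarith only [hσ1] : 1 / 2 < σ) (m * ℓ)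
  have hm2 := m_term_re_nonneg D₂ (by linarith only [hσ1] : 1 / 2 < σ) (m * ℓ)
  have hm3 := m_term_re_nonneg D₃ (by linarith only [hσ1] : 1 / 2 < σ) (m * ℓ)
  have two_re : ∀ w : ℂ, (2 * w).re = 2 * w.re := fun w ↦ by simp [Complex.mul_re]
  simp only [Complex.add_re, two_re] at hfam hre
  have hz₀m : (z₀ ^ m).re = ((r ^ ℓ)⁻¹) ^ m := by
    rw [hz₀r, ← Complex.ofReal_pow, Complex.ofReal_re]
  rw [hz₀m] at hre
  have hre' : 2 / 106 * ((r ^ ℓ)⁻¹) ^ m ≤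
      2 * ((r ^ ℓ)⁻¹) ^ m + (2 * N₀.re + (N₁.re + (N₂.re + N₃.re))) := by
    convert hre using 1; ring
  have hrM : ((r ^ ℓ)⁻¹) ^ m = (r ^ (m * ℓ))⁻¹ := by rw [inv_pow, ← pow_mul']
  -- ### the key inequality `(1/106)(e/δ)^M ≤ η^{−M} − (η + u₁)^{−M}`
  linarith only [hre', hfam, hN0, hN1, hN2, hN3, hm0, hm1', hm2, hm3, hrM]

/-- **The core contradiction.** Under `H_δ`, with the data of `powersum_step` at moduli above the
threshold `q₀ = exp(exp(10⁴/(δ³ε²)))`, real zeros `β₁` of `L(s,χ₁)` and `β₂` of `L(s,χ₂)` cannot BOTH satisfy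
`β_j ≥ 1 − (log q_j)^{−ε}`: with `η = δ/e + β₂ − 1`, `ℓ = ⌈log log q₁⌉`, the power-sum step, Lemma 3.4
(`bernoulli_step`) and the `ε`-margin (`log_step`) give `1 − β₂ ≥ (δ/e)·ε/312 > δε/1000 > (log q₀)^{−ε}`.
[cite: BasakThornerZaharescu2026, §3 (Proof of Theorem 1.1)] -/
theorem core_contradiction {δ₀ ε : ℝ} (hδ : 0 < δ₀) (hδ' : δ₀ < 1 / 10) (hH : LocalRealZeros δ₀)
    (hε : 0 < ε) (hε1 : ε < 1)
    {q₁ q₂ q₃ : ℕ} [NeZero q₁] [NeZero q₂] [NeZero q₃]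
    {χ₁ : DirichletCharacter ℂ q₁} {χ₂ : DirichletCharacter ℂ q₂} {χ₃ : DirichletCharacter ℂ q₃}
    (hχ₁ : χ₁.IsPrimitive) (h₁ : χ₁ ≠ 1) (hq₁ : χ₁.IsQuadratic)
    (hχ₂ : χ₂.IsPrimitive) (h₂ : χ₂ ≠ 1) (hq₂ : χ₂.IsQuadratic)
    (hχ₃ : χ₃.IsPrimitive) (h₃ : χ₃ ≠ 1) (hq₃ : χ₃.IsQuadratic)
    (hcoef : ∀ n : ℕ, 0 ≤ ((2 : ℂ) + (χ₁ n + χ₁⁻¹ n) + (χ₂ n + χ₂⁻¹ n) + (χ₃ n + χ₃⁻¹ n)).re)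
    (hq₂₁ : q₂ ≤ q₁) (hq₃₁₂ : q₃ ≤ q₁ * q₂) (hthr : threshold δ₀ ε ≤ q₂)
    {β₁ β₂ : ℝ} (hL₁ : χ₁.LFunction β₁ = 0) (hL₂ : χ₂.LFunction β₂ = 0) (hβ₁ : β₁ < 1) (hβ₂ : β₂ < 1)
    (hβ₁' : 1 - Real.log q₁ ^ (-ε) ≤ β₁) (hβ₂' : 1 - Real.log q₂ ^ (-ε) ≤ β₂) : False := by
  have he := Real.exp_one_lt_d9
  have he' := Real.exp_one_gt_d9
  have hΛ := exponent_ge hδ hδ' hε hε1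
  -- ### thresholds, `u_j = 1 − β_j < δε/1000`
  have hq₂₁r : (q₂ : ℝ) ≤ q₁ := by exact_mod_cast hq₂₁
  obtain ⟨hL1, -, hlog1, hpow1⟩ := threshold_facts hδ hε (hthr.trans hq₂₁r)
  obtain ⟨-, -, -, hpow2⟩ := threshold_facts hδ hε hthr
  have hτ := exp_neg_exponent_lt hδ hδ' hε
  have hside := side_margin hδ hε hε1
  have hu1 : 1 - β₁ < δ₀ * ε / 1000 := by linarith only [hpow1.trans_lt hτ, hβ₁']
  have hu2 : 1 - β₂ < δ₀ * ε / 1000 := by linarith only [hpow2.trans_lt hτ, hβ₂']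
  have hτsmall : δ₀ * ε / 1000 < 1 / 10000 := by nlinarith only [mul_pos hδ hε, hδ', hε1, hδ, hε]
  have hu1pos : 0 < 1 - β₁ := by linarith only [hβ₁]
  have hlogq1pos : 0 < Real.log q₁ := by linarith only [hlog1]
  -- ### `η = δ/e + β₂ − 1`
  set η : ℝ := δ₀ / Real.exp 1 - (1 - β₂) with hη_def
  have hr2 : δ₀ / (2 * Real.exp 1) = δ₀ / Real.exp 1 / 2 := by ring
  have hηlo : δ₀ / (2 * Real.exp 1) ≤ η := by linarith only [hside, hu2, hη_def, hr2]
  have hη0 : 0 < η := lt_of_lt_of_le (by positivity) hηlo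
  have hβ₂η : 1 + η - β₂ = δ₀ / Real.exp 1 := by rw [hη_def]; ring
  -- ### `ℓ = ⌈log log q₁⌉`
  set L₂ : ℝ := Real.log (Real.log q₁) with hL₂_def
  have hΛL₂ : 10000 / (δ₀ ^ 3 * ε ^ 2) ≤ L₂ := by
    rw [hL₂_def, Real.le_log_iff_exp_le hlogq1pos]; exact hL1
  have hL₂1 : 1 ≤ L₂ := by linarith only [hΛL₂, hΛ, pow_pos (by norm_num : (0:ℝ) < 10) 7]
  set ℓ : ℕ := ⌈L₂⌉₊ with hℓ_def
  have hℓ1 : L₂ ≤ ℓ := Nat.le_ceil L₂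
  have hℓ2 : (ℓ : ℝ) ≤ 2 * L₂ := by
    have := Nat.ceil_lt_add_one (by linarith only [hL₂1] : 0 ≤ L₂)
    linarith only [this, hL₂1]
  have hℓ2' : 2 ≤ ℓ := by
    have : (2 : ℝ) ≤ ℓ := by linarith only [hℓ1, hΛL₂, hΛ, pow_pos (by norm_num : (0:ℝ) < 10) 7]
    exact_mod_cast this
  have hexpℓ : Real.log q₁ ≤ Real.exp 1 ^ ℓ := by
    rw [Real.exp_one_pow]
    calc Real.log q₁ = Real.exp L₂ := by rw [hL₂_def, Real.exp_log hlogq1pos]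
      _ ≤ Real.exp ℓ := Real.exp_le_exp.mpr hℓ1
  -- ### Lemmas 3.1–3.3
  obtain ⟨m, -, hm39, hkey⟩ := powersum_step hδ hδ' hH hχ₁ h₁ hq₁ hχ₂ h₂ hq₂ hχ₃ h₃ hq₃ hcoef hq₂₁ hq₃₁₂
    (K_margin hδ hδ' hε hε1 hL1) hℓ2' hexpℓ hηlo hβ₂η hβ₁ (by linarith only [hu1, hτsmall]) hβ₂
    (by linarith only [hu2, hτsmall]) hL₁ hL₂
  -- ### Lemma 3.4 and the `ε`-margin
  have hr0 : 0 < δ₀ / Real.exp 1 := by positivity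
  have hB := bernoulli_step hη0 hu1pos hkey
  have hv : 1 / 106 * ((δ₀ / Real.exp 1) ^ (m * ℓ))⁻¹ * η ^ (m * ℓ) =
      1 / 106 * (η / (δ₀ / Real.exp 1)) ^ (m * ℓ) := by
    rw [div_pow η]; ring
  rw [hv] at hB
  have hu1exp : 1 - β₁ ≤ Real.exp (-(ε * L₂)) := by
    have : Real.log q₁ ^ (-ε) = Real.exp (-(ε * L₂)) := by
      rw [Real.rpow_def_of_pos hlogq1pos, hL₂_def]; ring_nf
    linarith only [this, hβ₁']
  have hMr : ((m * ℓ : ℕ) : ℝ) ≤ 39 * ℓ := by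
    push_cast
    exact mul_le_mul_of_nonneg_right hm39 (Nat.cast_nonneg ℓ)
  have hηr : η / (δ₀ / Real.exp 1) ≤ 1 := by
    rw [div_le_one hr0]; linarith only [hη_def, hβ₂]
  have hfin := log_step hδ hδ' hε hε1 hΛL₂ hℓ2 hηlo hu1pos.le hu1exp (by positivity) hηr hMr hB
  -- ### the contradiction: `1 − β₂ = (δ/e)(1 − v) ≥ (δ/e)ε/312 ≥ δε/1000 > 1 − β₂`
  rw [div_le_iff₀ hr0] at hfin
  have h2 : δ₀ * ε / 1000 ≤ δ₀ / Real.exp 1 * (ε / 312) := by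
    rw [div_mul_eq_mul_div, div_le_div_iff₀ (by norm_num) (Real.exp_pos 1)]
    nlinarith only [mul_pos hδ hε, he]
  have h3 : 1 - β₂ = δ₀ / Real.exp 1 - η := by rw [hη_def]; ring
  nlinarith only [hfin, h2, h3, hu2, hr0, hε]

end Core

/-! ### §B.8 From two real primitive characters to the family `ζ·L(χ₁)·L(χ₂)·L(ψ)` -/

section Glue

open DirichletCharacter

/-- Quadratic characters stay quadratic under `changeLevel`
(cf. `Literature.Barriers.RiemannHypothesis.isQuadratic_changeLevel`). [folklore] -/
private theorem isQuadratic_changeLevel' {D N : ℕ} (h : D ∣ N) {χ : DirichletCharacter ℂ D}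
    (hχ : χ.IsQuadratic) : (changeLevel h χ).IsQuadratic := by
  intro a
  by_cases ha : IsUnit a
  · obtain ⟨u, rfl⟩ := ha
    rw [changeLevel_eq_cast_of_dvd]
    exact hχ _
  · exact Or.inl (MulChar.map_nonunit _ ha)

/-- … and descend along `changeLevel`: every unit lifts (`ZMod.unitsMap_surjective`)
(cf. `Literature.NumberTheory.EllipticCurves.isQuadratic_of_isQuadratic_changeLevel`). [folklore] -/
private theorem isQuadratic_of_changeLevel' {D N : ℕ} [NeZero N] (h : D ∣ N)
    {χ : DirichletCharacter ℂ D} (hχ : (changeLevel h χ).IsQuadratic) : χ.IsQuadratic := by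
  intro a
  by_cases ha : IsUnit a
  · obtain ⟨U, hU⟩ := ZMod.unitsMap_surjective h ha.unit
    have hval : changeLevel h χ (U : ZMod N) = χ a := by
      rw [changeLevel_eq_cast_of_dvd χ h U, ← ZMod.unitsMap_val h U, hU, IsUnit.unit_spec]
    rw [← hval]
    exact hχ _
  · exact Or.inl (MulChar.map_nonunit χ ha)

/-- Products of quadratic characters are quadratic. [folklore] -/
private theorem isQuadratic_mul' {N : ℕ} {χ ψ : DirichletCharacter ℂ N} (hχ : χ.IsQuadratic)
    (hψ : ψ.IsQuadratic) : (χ * ψ).IsQuadratic := by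
  intro a
  rw [MulChar.mul_apply]
  rcases hχ a with h | h | h <;> rcases hψ a with h' | h' | h' <;> simp [h, h']

/-- A primitive character of level `q > 1` is not trivial. [folklore] -/
private theorem ne_one_of_isPrimitive {q : ℕ} [NeZero q] {χ : DirichletCharacter ℂ q}
    (hχ : χ.IsPrimitive) (hq : 1 < q) : χ ≠ 1 := by
  rintro rfl
  rw [isPrimitive_def, conductor_one] at hχ
  omega

/-- Primitive characters of distinct levels have distinct lifts to level `q₁q₂` (the conductor is
`changeLevel`-invariant, Mathlib `conductor_changeLevel`). [folklore] -/
private theorem changeLevel_ne_of_level_ne {q₁ q₂ : ℕ} [NeZero q₁] [NeZero q₂]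
    {χ₁ : DirichletCharacter ℂ q₁} {χ₂ : DirichletCharacter ℂ q₂} (hχ₁ : χ₁.IsPrimitive)
    (hχ₂ : χ₂.IsPrimitive) (h : q₁ ≠ q₂) :
    changeLevel (dvd_mul_right q₁ q₂) χ₁ ≠ changeLevel (dvd_mul_left q₂ q₁) χ₂ := by
  haveI : NeZero (q₁ * q₂) := ⟨mul_ne_zero (NeZero.ne q₁) (NeZero.ne q₂)⟩
  intro he
  have := congrArg DirichletCharacter.conductor he
  rw [conductor_changeLevel, conductor_changeLevel, (isPrimitive_def χ₁).mp hχ₁,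
    (isPrimitive_def χ₂).mp hχ₂] at this
  exact h this

/-- **The reduction to the core** (print, §2: «Let `ψ` be the primitive Dirichlet character that
induces `χ₁χ₂`. It follows that `ψ` is real, with conductor at most `q₁²`», and
`D(s) = ζ(s)L(s,χ₁)L(s,χ₂)L(s,ψ)` has non-negative Dirichlet coefficients): for real primitive `χ₁ (mod q₁)`,
`χ₂ (mod q₂)` with DISTINCT lifts to level `q₁q₂`, `q₀ ≤ q₂ ≤ q₁`, real zeros `β_j ≥ 1 − (log q_j)^{−ε}`
are contradictory under `H_δ`. Here `ψ := (χ₁'χ₂').primitiveCharacter`, `ψ ≠ 1` because `χ₁' ≠ χ₂'`,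
and the coefficient sign is `re_coeff_nonneg`. [cite: BasakThornerZaharescu2026, §2–§3] -/
theorem contradiction_of_zeros_near_one {δ₀ ε : ℝ} (hδ : 0 < δ₀) (hδ' : δ₀ < 1 / 10)
    (hH : LocalRealZeros δ₀) (hε : 0 < ε) (hε1 : ε < 1) {q₁ q₂ : ℕ} [NeZero q₁] [NeZero q₂]
    {χ₁ : DirichletCharacter ℂ q₁} {χ₂ : DirichletCharacter ℂ q₂}
    (hq₁ : χ₁.IsQuadratic) (hχ₁ : χ₁.IsPrimitive) (hq₂ : χ₂.IsQuadratic) (hχ₂ : χ₂.IsPrimitive)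
    (hne : changeLevel (dvd_mul_right q₁ q₂) χ₁ ≠ changeLevel (dvd_mul_left q₂ q₁) χ₂)
    (hq₂₁ : q₂ ≤ q₁) (hthr : threshold δ₀ ε ≤ q₂)
    {β₁ β₂ : ℝ} (hL₁ : χ₁.LFunction β₁ = 0) (hL₂ : χ₂.LFunction β₂ = 0) (hβ₁ : β₁ < 1)
    (hβ₂ : β₂ < 1) (hβ₁' : 1 - Real.log q₁ ^ (-ε) ≤ β₁) (hβ₂' : 1 - Real.log q₂ ^ (-ε) ≤ β₂) :
    False := by
  haveI : NeZero (q₁ * q₂) := ⟨mul_ne_zero (NeZero.ne q₁) (NeZero.ne q₂)⟩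
  -- `q₁ ≥ q₂ > 1`, so `χ₁, χ₂ ≠ 1`
  obtain ⟨-, hq2gt, -, -⟩ := threshold_facts hδ hε hthr
  have hq2gt' : 1 < q₂ := by exact_mod_cast hq2gt
  have h₁ : χ₁ ≠ 1 := ne_one_of_isPrimitive hχ₁ (lt_of_lt_of_le hq2gt' hq₂₁)
  have h₂ : χ₂ ≠ 1 := ne_one_of_isPrimitive hχ₂ hq2gt'
  -- `ψ` = the primitive character inducing `χ₁χ₂`
  set P : DirichletCharacter ℂ (q₁ * q₂) :=
    changeLevel (dvd_mul_right q₁ q₂) χ₁ * changeLevel (dvd_mul_left q₂ q₁) χ₂ with hP_def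
  haveI : NeZero P.conductor := ⟨conductor_ne_zero P⟩
  have hPq : P.IsQuadratic :=
    isQuadratic_mul' (isQuadratic_changeLevel' _ hq₁) (isQuadratic_changeLevel' _ hq₂)
  have hPψ : changeLevel P.conductor_dvd_level P.primitiveCharacter = P :=
    changeLevel_primitiveCharacter P
  have hψq : P.primitiveCharacter.IsQuadratic :=
    isQuadratic_of_changeLevel' P.conductor_dvd_level (by rw [hPψ]; exact hPq)
  have hψprim : P.primitiveCharacter.IsPrimitive := primitiveCharacter_isPrimitive P
  have hψ1 : P.primitiveCharacter ≠ 1 := by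
    intro h1
    have hP1 : P = 1 := by rw [← hPψ, h1, map_one]
    have hprod : changeLevel (dvd_mul_right q₁ q₂) χ₁ * changeLevel (dvd_mul_left q₂ q₁) χ₂ = 1 := by
      rw [← hP_def]; exact hP1
    apply hne
    rw [eq_inv_of_mul_eq_one_left hprod, ← map_inv, hq₂.inv]
  -- the Dedekind non-negativity of `−D'/D`
  have hcoef : ∀ n : ℕ, 0 ≤ ((2 : ℂ) + (χ₁ n + χ₁⁻¹ n) + (χ₂ n + χ₂⁻¹ n) +
      (P.primitiveCharacter n + (P.primitiveCharacter)⁻¹ n)).re := by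
    intro n
    have h := re_coeff_nonneg hχ₁ hχ₂ hq₁ hq₂ hψq P.conductor_dvd_level hPψ n
    rw [hq₁.inv, hq₂.inv, hψq.inv]
    have e : ((2 : ℂ) + (χ₁ n + χ₁ n) + (χ₂ n + χ₂ n) + (P.primitiveCharacter n + P.primitiveCharacter n)) =
        2 * (1 + χ₁ n + χ₂ n + P.primitiveCharacter n) := by ring
    rw [e, show ∀ w : ℂ, (2 * w).re = 2 * w.re from fun w ↦ by simp [Complex.mul_re]]
    exact mul_nonneg zero_le_two h
  have hq₃ : P.conductor ≤ q₁ * q₂ :=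
    Nat.le_of_dvd (Nat.pos_of_ne_zero (NeZero.ne _)) P.conductor_dvd_level
  exact core_contradiction hδ hδ' hH hε hε1 hχ₁ h₁ hq₁ hχ₂ h₂ hq₂ hψprim hψ1 hψq hcoef hq₂₁ hq₃ hthr
    hL₁ hL₂ hβ₁ hβ₂ hβ₁' hβ₂'

end Glue

end BasakThornerZaharescu2026

/-! ## The discharge of the named fact `basakThornerZaharescu2026_theorem11` -/

open BasakThornerZaharescu2026 DirichletCharacter in
/-- **Basak–Thorner–Zaharescu 2026, Theorem 1.1 — DISCHARGED** (both clauses of the tree's rendering: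
distinct moduli, and distinct characters of one modulus; in the first, without loss of generality
`q₂ ≤ q₁` by symmetry). DECLARED DEVIATION from print (see the module docstring): Lemma 3.2's zero
count `K ≤ 5` via [BMOR2021] is replaced by the order-2 `M`-bound (`K ≤ 3` in the weighted
normalisation used here), and Turán's `1/8, k ≤ 24K` by the Kolesnikov–Straus constants `1/106, m ≤ 13K`
of `PowerSum.exists_re_tsum_powerSum_ge`; the printed threshold `q₀ = exp(exp(10⁴/(δ³ε²)))` is kept
VERBATIM and absorbs both. [cite: BasakThornerZaharescu2026, Theorem 1.1] -/
theorem basakThornerZaharescu2026_theorem11_holds : basakThornerZaharescu2026_theorem11 := by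
  intro δ₀ hδ hδ' hH ε hε hε1
  refine ⟨?_, ?_⟩
  · intro q₁ q₂ _ _ χ₁ χ₂ hq12 hthr₁ hthr₂ hq₁ hχ₁ hq₂ hχ₂ β₁ β₂ hL₁ hL₂ hβ₁ hβ₂
    by_contra h
    push Not at h
    obtain ⟨hβ₁', hβ₂'⟩ := h
    rcases le_total q₂ q₁ with hle | hle
    · exact contradiction_of_zeros_near_one hδ hδ' hH hε hε1 hq₁ hχ₁ hq₂ hχ₂
        (changeLevel_ne_of_level_ne hχ₁ hχ₂ hq12) hle hthr₂ hL₁ hL₂ hβ₁ hβ₂ hβ₁' hβ₂'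
    · exact contradiction_of_zeros_near_one hδ hδ' hH hε hε1 hq₂ hχ₂ hq₁ hχ₁
        (changeLevel_ne_of_level_ne hχ₂ hχ₁ (Ne.symm hq12)) hle hthr₁ hL₂ hL₁ hβ₂ hβ₁ hβ₂' hβ₁'
  · intro q _ χ₁ χ₂ hne hthr hq₁ hχ₁ hq₂ hχ₂ β₁ β₂ hL₁ hL₂ hβ₁ hβ₂
    by_contra h
    push Not at h
    obtain ⟨hβ₁', hβ₂'⟩ := h
    haveI : NeZero (q * q) := ⟨mul_ne_zero (NeZero.ne q) (NeZero.ne q)⟩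
    exact contradiction_of_zeros_near_one hδ hδ' hH hε hε1 hq₁ hχ₁ hq₂ hχ₂
      (fun he ↦ hne (changeLevel_injective _ he)) le_rfl hthr hL₁ hL₂ hβ₁ hβ₂ hβ₁' hβ₂'

/-! ## Stage C: Corollary 1.4 and the column's consequences of `H_δ`, now fed with Theorem 1.1

Corollary 1.4 was already derived from the named fact Theorem 1.1 in the statement file
(`basakThornerZaharescu2026_corollary14_of_theorem11`); feeding it `basakThornerZaharescu2026_theorem11_holds`
discharges the second named fact of the file and makes the statement file's «modulo Corollary 1.4» theorems
hypothesis-free in everything but `H_δ` itself (which stays a HYPOTHESIS — an open problem, never asserted).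
-/

section Consequences

open BasakThornerZaharescu2026 Literature.Barriers.Parity

/-- **Basak–Thorner–Zaharescu 2026, Corollary 1.4 — DISCHARGED** (as typed: for `0 < δ < 1/10` under `H_δ`,
every `ε > 0` admits `c(δ,ε) > 0` with `L(σ,χ) ≠ 0` for `σ ≥ 1 − c(log q)^{−ε}`, `χ` primitive quadratic mod
`q ≥ 3`), from Theorem 1.1 via the statement file's `basakThornerZaharescu2026_corollary14_of_theorem11`.
[cite: BasakThornerZaharescu2026, Corollary 1.4] -/
theorem basakThornerZaharescu2026_corollary14_holds : basakThornerZaharescu2026_corollary14 :=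
  basakThornerZaharescu2026_corollary14_of_theorem11 basakThornerZaharescu2026_theorem11_holds

/-- **`H_δ` ⇒ Siegel zeros have bounded quality** (`¬ UnboundedSiegelZeros`), now modulo nothing but `H_δ`.
[cite: BasakThornerZaharescu2026, Corollary 1.4] [cite: TaoTeravainen2021, Definition 1.4] -/
theorem BasakThornerZaharescu2026.not_unboundedSiegelZeros_of_localRealZeros {δ₀ : ℝ} (hδ : 0 < δ₀)
    (hδ' : δ₀ < 1 / 10) (hH : LocalRealZeros δ₀) : ¬ Summit.Parity.GeneralizedHardyLittlewood.UnboundedSiegelZeros :=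
  hH.not_unboundedSiegelZeros basakThornerZaharescu2026_corollary14_holds hδ hδ'

/-- **`H_δ` ⇒ `NoSiegelZeros`** (any fixed `0 < δ < 1/10`), modulo nothing but `H_δ`.
[cite: BasakThornerZaharescu2026, Theorem 1.1 and Corollary 1.4] -/
theorem BasakThornerZaharescu2026.noSiegelZeros_of_localRealZeros {δ₀ : ℝ} (hδ : 0 < δ₀)
    (hδ' : δ₀ < 1 / 10) (hH : LocalRealZeros δ₀) : NoSiegelZeros :=
  hH.noSiegelZeros basakThornerZaharescu2026_corollary14_holds hδ hδ'

/-- **Sarnak–Zaharescu's Hypothesis H ⇒ `NoSiegelZeros`** (via `H ⇒ H_{1/20}` and Corollary 1.4), the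
hypothesis-free form of `ModifiedGRH.noSiegelZeros_of_corollary14`.
[cite: BasakThornerZaharescu2026, Corollary 1.4] [cite: SarnakZaharescu2002, Hypothesis H (p. 496)] -/
theorem ModifiedGRH.noSiegelZeros (hH : ModifiedGRH) : NoSiegelZeros :=
  hH.noSiegelZeros_of_corollary14 basakThornerZaharescu2026_corollary14_holds

/-- **`H_δ` refutes `PolylogExceptionalZeros k` for every `k > 0`** (Ford's large-gap hypothesis), modulo
nothing but `H_δ`. [cite: BasakThornerZaharescu2026, Corollary 1.4]
[cite: Ford2019LargePrimeGaps, §1, example after Theorem 1.4] -/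
theorem BasakThornerZaharescu2026.not_polylogExceptionalZeros_of_localRealZeros {δ₀ : ℝ} (hδ : 0 < δ₀)
    (hδ' : δ₀ < 1 / 10) (hH : LocalRealZeros δ₀) {k : ℝ} (hk : 0 < k) :
    ¬ Ford2020.PolylogExceptionalZeros k :=
  hH.not_polylogExceptionalZeros basakThornerZaharescu2026_corollary14_holds hδ hδ' hk

/-- **`H_δ` refutes Wright's `StrongSiegelZeros A` for every `A ≥ 0`**, modulo nothing but `H_δ`.
[cite: BasakThornerZaharescu2026, Corollary 1.4] [cite: Wright2023PrimeTuplesSiegel, §3 Main Result] -/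
theorem BasakThornerZaharescu2026.not_strongSiegelZeros_of_localRealZeros {δ₀ : ℝ} (hδ : 0 < δ₀)
    (hδ' : δ₀ < 1 / 10) (hH : LocalRealZeros δ₀) {A : ℝ} (hA : 0 ≤ A) :
    ¬ WrightPrimeTuples.StrongSiegelZeros A :=
  hH.not_strongSiegelZeros basakThornerZaharescu2026_corollary14_holds hδ hδ' hA

end Consequences

end Literature.NumberTheory.LFunctions

end
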